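import Literature.NumberTheory.Sieve.HeathBrownPrincipalEstimateCore
import Literature.NumberTheory.Sieve.HeathBrownSSumLemma4

/-!
# Heath-Brown's Lemma 5 for the box sum of `g_s`, and Fouvry–Tenenbaum's Lemma 4.13 at `θ = 1/2 + 1/85`

Sources: D. R. Heath-Brown, *The divisor function `d₃(n)` in arithmetic progressions*, Acta Arith. 47
(1986), §2, §4, §7 [cite: HeathBrown1986d3]; É. Fouvry, G. Tenenbaum, *Multiplicative functions in large
arithmetic progressions and applications*, Trans. AMS (2021), Lemma 4.13 [cite: FouvryTenenbaum2021].
No named facts are introduced.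

* **Lemma 5 for the box sum of `g_s`** (`abs_boxSum_gAP_le_principal`): the full expansion of
  `∑_{B₁×B₂×B₃} g_s(uvw; a)` (`boxSum_gAP_eq`, HB (2.3)–(2.4)), the `N₁`-trick "`N₁` is independent of
  `a`" done by averaging over the reduced classes (`boxSum_gAP_sub`, `sum_units_gAP_eq_zero`,
  `abs_boxSum_gAP_le_of_MAIN`), the removal of the `mod D` twist (`MAIN_eq_core`), and `core_lemma5`.
* **§7 / FT Lemma 4.13 at `θ = 1/2 + 1/85`** (`lemma413_of_L4all_deligne`): conditionally on a
  Lemma-4-type bound `|S(k,t;ρ,σ;s)| ≤ C_L d(s)^{c_L} s^{5/2} · L4shape` at all moduli `s` (HB Lemma 4,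
  i.e. Weil + Birch–Bombieri) and on Deligne's prime bound for `K₂`, the named fact
  `FouvryTenenbaum2021_lemma413` holds: the three estimates `abs_boxSum_gAP_le_principal` (Lemma 5),
  `abs_sum_apBox3_gAP_le` (Lemma 6 type) and `sum3_gAP_le` (Lemma 7) according to the shape of the boxes
  (`M₁ ≤ x^{0.23}`; `M₃ ≤ x^{0.4637}`; otherwise), with `δ = 10⁻⁴` (numerology `num_caseA/B/C`; the
  threshold of the method is `θ < 21/41`, cf. FT "`q ≤ x^{21/41−ε}`").
-/

open Finset

namespace Literature.NumberTheory.Sieve.HeathBrown1986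

open Literature.NumberTheory.Sieve.Vinogradov (distInt distInt_nonneg)
open Literature.NumberTheory.Sieve.FouvryTenenbaum2021 (gAP lemma412_card_filter_isUnit
  card_apBox_le_two_mul mul_le_rpow_two_thirds coprime_of_isCoprime_mul abs_sum_apBox3_gAP_le)
open Literature.NumberTheory.LFunctions (kloostermanSum kloostermanSum_comm)

variable {q : ℕ} [NeZero q]

/-! ### The `E(t)` identity and the full expansion of the box sum -/

section Expansion

variable {s : ℕ} [NeZero s]

/-- `E(t) = ∑_{u ∈ B₁*} ∑_{v ∈ B₂*} e_s((−tα) ū v̄) − #B₁* #B₂* K` (identity form of `norm_E_le'`).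
[folklore] -/
theorem E_eq (α : ZMod s) (B₁ B₂ : Finset ℕ) (t : ZMod s) (K : ℂ) :
    ∑ u ∈ B₁, ∑ v ∈ B₂, (if IsUnit ((u * v : ℕ) : ZMod s) then
        ((ZMod.stdAddChar (-(t * (α * ((u * v : ℕ) : ZMod s)⁻¹))) : ℂ) - K) else 0) =
      ∑ u ∈ unitsIn s B₁, ∑ v ∈ unitsIn s B₂,
          (ZMod.stdAddChar ((-t * α) * (((u : ZMod s))⁻¹ * ((v : ZMod s))⁻¹)) : ℂ) -
        ((unitsIn s B₁).card : ℂ) * ((unitsIn s B₂).card : ℂ) * K := by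
  classical
  set ψ : AddChar (ZMod s) ℂ := ZMod.stdAddChar with hψ
  have hU : unitsIn s B₁ = B₁.filter (fun u : ℕ => IsUnit (u : ZMod s)) := by
    ext u; rw [Finset.mem_filter, mem_unitsIn, ZMod.isUnit_iff_coprime]
  have hV : unitsIn s B₂ = B₂.filter (fun v : ℕ => IsUnit (v : ZMod s)) := by
    ext v; rw [Finset.mem_filter, mem_unitsIn, ZMod.isUnit_iff_coprime]
  have hsum : ∑ u ∈ B₁, ∑ v ∈ B₂, (if IsUnit ((u * v : ℕ) : ZMod s) then
      ((ψ (-(t * (α * ((u * v : ℕ) : ZMod s)⁻¹))) : ℂ) - K) else 0) =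
      ∑ u ∈ unitsIn s B₁, (∑ v ∈ unitsIn s B₂,
        (ψ ((-t * α) * (((u : ZMod s))⁻¹ * ((v : ZMod s))⁻¹)) : ℂ) - (unitsIn s B₂).card * K) := by
    rw [hU, Finset.sum_filter]
    refine Finset.sum_congr rfl fun u _ => ?_
    split_ifs with hu
    · rw [hV, Finset.sum_filter]
      have hcard : ((B₂.filter (fun v : ℕ => IsUnit (v : ZMod s))).card : ℂ) * K =
          ∑ v ∈ B₂, (if IsUnit (v : ZMod s) then K else 0) := by
        rw [Finset.sum_ite, Finset.sum_const_zero, add_zero, Finset.sum_const, nsmul_eq_mul]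
      rw [hcard, ← Finset.sum_sub_distrib]
      refine Finset.sum_congr rfl fun v _ => ?_
      by_cases hv : IsUnit (v : ZMod s)
      · have huv : IsUnit ((u * v : ℕ) : ZMod s) := by rw [Nat.cast_mul]; exact hu.mul hv
        rw [if_pos huv, if_pos hv, if_pos hv]
        congr 2
        rw [Nat.cast_mul, mul_inv_of_isUnit hu hv]; ring
      · have huv : ¬ IsUnit ((u * v : ℕ) : ZMod s) := by
          rw [Nat.cast_mul]; exact fun h => hv (IsUnit.mul_iff.mp h).2
        rw [if_neg huv, if_neg hv, if_neg hv, sub_zero]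
    · refine Finset.sum_eq_zero fun v _ => ?_
      have huv : ¬ IsUnit ((u * v : ℕ) : ZMod s) := by
        rw [Nat.cast_mul]; exact fun h => hu (IsUnit.mul_iff.mp h).1
      rw [if_neg huv]
  rw [hsum, Finset.sum_sub_distrib, Finset.sum_const, nsmul_eq_mul]
  ring

/-- **Full expansion of the box sum** (HB (2.3)–(2.4) in the `g_s`-normalisation):
`∑_{B₁×B₂×B₃} g_s(uvw; a) = s⁻¹ ∑_t F(t)·(s⁻² ∑_{r,σ} G₁(r)G₂(σ)K₂(−r,−σ,−tα) − #B₁*#B₂* c_s(−t)/φ(s))`.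
[cite: HeathBrown1986d3, §2 (2.3)–(2.4)] -/
theorem boxSum_gAP_eq {a : ℤ} (ha : IsUnit (a : ZMod s)) (B₁ B₂ B₃ : Finset ℕ) (hB₁ : ∀ u ∈ B₁, 1 ≤ u) :
    (((∑ u ∈ B₁, ∑ v ∈ B₂, ∑ w ∈ B₃, gAP s a (u * v * w) : ℝ)) : ℂ) =
      (s : ℂ)⁻¹ * ∑ t : ZMod s,
        ((s : ℂ)⁻¹ * ∑ r : ZMod s, (∑ u ∈ B₁, (ZMod.stdAddChar (r * (u : ZMod s)) : ℂ)) *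
            ((s : ℂ)⁻¹ * ∑ σ : ZMod s, (∑ v ∈ B₂, (ZMod.stdAddChar (σ * (v : ZMod s)) : ℂ)) *
              K2 s (-r) (-σ) (-t * (a : ZMod s))) -
          ((unitsIn s B₁).card : ℂ) * ((unitsIn s B₂).card : ℂ) * (kloostermanSum s (-t) 0 / (Nat.totient s : ℂ))) *
        (∑ w ∈ B₃, (ZMod.stdAddChar (t * (w : ZMod s)) : ℂ)) := by
  rw [sum_gAP_three_eq_fourier ha B₁ B₂ B₃ hB₁]
  congr 1
  refine Finset.sum_congr rfl fun t _ => ?_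
  rw [E_eq, sum_units_stdAddChar_inv_inv_eq]

end Expansion

/-! ### The `N₁`-trick: the complement of the nonzero octant does not depend on the unit `a` -/

/-- Off the nonzero octant, `K₂(−r, −σ, −tα)` is the same for all units `α`. [cite: HeathBrown1986d3, §4 p.41] -/
theorem K2_eq_of_not_octant {α β : ZMod q} (hα : IsUnit α) (hβ : IsUnit β) {r σ t : ZMod q}
    (h : ¬ (r ≠ 0 ∧ σ ≠ 0 ∧ t ≠ 0)) :
    K2 q (-r) (-σ) (-t * α) = K2 q (-r) (-σ) (-t * β) := by
  by_cases hr : r = 0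
  · rw [hr, neg_zero, show -t * α = α * (-t) by ring, show -t * β = β * (-t) by ring,
      K2_first_zero_unit_mul hα, K2_first_zero_unit_mul hβ]
  by_cases hσ : σ = 0
  · rw [hσ, neg_zero, show -t * α = α * (-t) by ring, show -t * β = β * (-t) by ring,
      K2_second_zero_unit_mul hα, K2_second_zero_unit_mul hβ]
  by_cases ht : t = 0
  · rw [ht, neg_zero, zero_mul, zero_mul]
  exact absurd ⟨hr, hσ, ht⟩ h

section Main

variable {s : ℕ} [NeZero s]

/-- The box Fourier transform `G_B(r) = ∑_{m ∈ B} e_s(rm)`. [folklore] -/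
noncomputable def boxG (s : ℕ) [NeZero s] (B : Finset ℕ) (r : ZMod s) : ℂ :=
  ∑ m ∈ B, (ZMod.stdAddChar (r * (m : ZMod s)) : ℂ)

/-- **The principal part** `MAIN(α) = s⁻³ ∑_{r,σ,t ≠ 0} G₁(r) G₂(σ) F₃(t) K₂(−r, −σ, −tα)`.
[cite: HeathBrown1986d3, §4 (start of the proof of Lemma 5)] -/
noncomputable def MAIN (s : ℕ) [NeZero s] (B₁ B₂ B₃ : Finset ℕ) (α : ZMod s) : ℂ :=
  ((s : ℂ)⁻¹) ^ 3 * ∑ r ∈ (Finset.univ : Finset (ZMod s)).filter (fun r => r ≠ 0),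
    ∑ σ ∈ (Finset.univ : Finset (ZMod s)).filter (fun σ => σ ≠ 0),
      ∑ t ∈ (Finset.univ : Finset (ZMod s)).filter (fun t => t ≠ 0),
        boxG s B₁ r * boxG s B₂ σ * boxG s B₃ t * K2 s (-r) (-σ) (-t * α)

/-- **`N(a) − N(b) = MAIN(a) − MAIN(b)`**: the box sums of `g_s(·; a)` and `g_s(·; b)` differ only in
their principal parts (the complement of the nonzero octant and the Ramanujan term are `a`-free).
[cite: HeathBrown1986d3, §4 p.41 ("`N₁` is independent of `a`")] -/
theorem boxSum_gAP_sub {a b : ℤ} (ha : IsUnit (a : ZMod s)) (hb : IsUnit (b : ZMod s))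
    (B₁ B₂ B₃ : Finset ℕ) (hB₁ : ∀ u ∈ B₁, 1 ≤ u) :
    (((∑ u ∈ B₁, ∑ v ∈ B₂, ∑ w ∈ B₃, gAP s a (u * v * w) : ℝ)) : ℂ) -
        (((∑ u ∈ B₁, ∑ v ∈ B₂, ∑ w ∈ B₃, gAP s b (u * v * w) : ℝ)) : ℂ) =
      MAIN s B₁ B₂ B₃ (a : ZMod s) - MAIN s B₁ B₂ B₃ (b : ZMod s) := by
  classical
  set NZ := (Finset.univ : Finset (ZMod s)).filter (fun t => t ≠ 0) with hNZ
  set Δ : ZMod s → ZMod s → ZMod s → ℂ := fun r σ t =>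
    K2 s (-r) (-σ) (-t * (a : ZMod s)) - K2 s (-r) (-σ) (-t * (b : ZMod s)) with hΔ
  have hΔ0 : ∀ r σ t : ZMod s, ¬ (r ≠ 0 ∧ σ ≠ 0 ∧ t ≠ 0) → Δ r σ t = 0 := fun r σ t h => by
    simp only [hΔ]; rw [K2_eq_of_not_octant ha hb h, sub_self]
  rw [boxSum_gAP_eq ha B₁ B₂ B₃ hB₁, boxSum_gAP_eq hb B₁ B₂ B₃ hB₁, ← mul_sub, ← Finset.sum_sub_distrib]
  -- each `t`-summand, expanded
  have hX : ∀ (α : ZMod s) (t : ZMod s),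
      ((s : ℂ)⁻¹ * ∑ r : ZMod s, boxG s B₁ r * ((s : ℂ)⁻¹ * ∑ σ : ZMod s, boxG s B₂ σ * K2 s (-r) (-σ) (-t * α))) *
        boxG s B₃ t =
      ∑ r : ZMod s, ∑ σ : ZMod s, ((s : ℂ)⁻¹) ^ 2 * (boxG s B₁ r * boxG s B₂ σ * boxG s B₃ t) * K2 s (-r) (-σ) (-t * α) := by
    intro α t
    simp only [Finset.mul_sum, Finset.sum_mul]
    exact Finset.sum_congr rfl fun r _ => Finset.sum_congr rfl fun σ _ => by ring
  have hdiff : ∀ t : ZMod s,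
      ((s : ℂ)⁻¹ * ∑ r : ZMod s, boxG s B₁ r * ((s : ℂ)⁻¹ * ∑ σ : ZMod s, boxG s B₂ σ * K2 s (-r) (-σ) (-t * (a : ZMod s))) -
          ((unitsIn s B₁).card : ℂ) * ((unitsIn s B₂).card : ℂ) * (kloostermanSum s (-t) 0 / (Nat.totient s : ℂ))) *
        boxG s B₃ t -
      ((s : ℂ)⁻¹ * ∑ r : ZMod s, boxG s B₁ r * ((s : ℂ)⁻¹ * ∑ σ : ZMod s, boxG s B₂ σ * K2 s (-r) (-σ) (-t * (b : ZMod s))) -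
          ((unitsIn s B₁).card : ℂ) * ((unitsIn s B₂).card : ℂ) * (kloostermanSum s (-t) 0 / (Nat.totient s : ℂ))) *
        boxG s B₃ t =
      ∑ r : ZMod s, ∑ σ : ZMod s, ((s : ℂ)⁻¹) ^ 2 * (boxG s B₁ r * boxG s B₂ σ * boxG s B₃ t) * Δ r σ t := by
    intro t
    have key : ∀ Xa Xb R F : ℂ, (Xa - R) * F - (Xb - R) * F = Xa * F - Xb * F := by intros; ring
    rw [key, hX, hX, ← Finset.sum_sub_distrib]
    refine Finset.sum_congr rfl fun r _ => ?_
    rw [← Finset.sum_sub_distrib]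
    refine Finset.sum_congr rfl fun σ _ => ?_
    simp only [hΔ]; ring
  -- unfold `boxG` in the goal's expansion (it is stated with explicit sums)
  simp only [boxG] at hdiff ⊢
  rw [Finset.sum_congr rfl (fun t _ => hdiff t)]
  -- restrict to the nonzero octant and reorder
  have hoct : ∑ t : ZMod s, ∑ r : ZMod s, ∑ σ : ZMod s,
      ((s : ℂ)⁻¹) ^ 2 * ((∑ m ∈ B₁, (ZMod.stdAddChar (r * (m : ZMod s)) : ℂ)) *
        (∑ m ∈ B₂, (ZMod.stdAddChar (σ * (m : ZMod s)) : ℂ)) * (∑ m ∈ B₃, (ZMod.stdAddChar (t * (m : ZMod s)) : ℂ))) * Δ r σ t =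
      ∑ r ∈ NZ, ∑ σ ∈ NZ, ∑ t ∈ NZ,
      ((s : ℂ)⁻¹) ^ 2 * ((∑ m ∈ B₁, (ZMod.stdAddChar (r * (m : ZMod s)) : ℂ)) *
        (∑ m ∈ B₂, (ZMod.stdAddChar (σ * (m : ZMod s)) : ℂ)) * (∑ m ∈ B₃, (ZMod.stdAddChar (t * (m : ZMod s)) : ℂ))) * Δ r σ t := by
    -- reorder `t` innermost
    rw [Finset.sum_comm]
    have e1 : ∀ r : ZMod s, ∑ t : ZMod s, ∑ σ : ZMod s,
        ((s : ℂ)⁻¹) ^ 2 * ((∑ m ∈ B₁, (ZMod.stdAddChar (r * (m : ZMod s)) : ℂ)) *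
          (∑ m ∈ B₂, (ZMod.stdAddChar (σ * (m : ZMod s)) : ℂ)) * (∑ m ∈ B₃, (ZMod.stdAddChar (t * (m : ZMod s)) : ℂ))) * Δ r σ t =
        ∑ σ : ZMod s, ∑ t : ZMod s,
        ((s : ℂ)⁻¹) ^ 2 * ((∑ m ∈ B₁, (ZMod.stdAddChar (r * (m : ZMod s)) : ℂ)) *
          (∑ m ∈ B₂, (ZMod.stdAddChar (σ * (m : ZMod s)) : ℂ)) * (∑ m ∈ B₃, (ZMod.stdAddChar (t * (m : ZMod s)) : ℂ))) * Δ r σ t :=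
      fun r => Finset.sum_comm
    rw [Finset.sum_congr rfl (fun r _ => e1 r)]
    -- drop the zero terms
    have hz : ∀ r σ t : ZMod s, ¬ (r ≠ 0 ∧ σ ≠ 0 ∧ t ≠ 0) →
        ((s : ℂ)⁻¹) ^ 2 * ((∑ m ∈ B₁, (ZMod.stdAddChar (r * (m : ZMod s)) : ℂ)) *
          (∑ m ∈ B₂, (ZMod.stdAddChar (σ * (m : ZMod s)) : ℂ)) * (∑ m ∈ B₃, (ZMod.stdAddChar (t * (m : ZMod s)) : ℂ))) * Δ r σ t = 0 :=
      fun r σ t h => by rw [hΔ0 r σ t h, mul_zero]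
    symm
    rw [hNZ, Finset.sum_filter_of_ne]
    · refine Finset.sum_congr rfl fun r _ => ?_
      rw [Finset.sum_filter_of_ne]
      · refine Finset.sum_congr rfl fun σ _ => ?_
        rw [Finset.sum_filter_of_ne]
        intro t _ hne ht
        exact hne (hz r σ t (fun h => h.2.2 ht))
      · intro σ _ hne hσ
        apply hne
        exact Finset.sum_eq_zero fun t _ => hz r σ t (fun h => h.2.1 hσ)
    · intro r _ hne hr
      apply hne
      exact Finset.sum_eq_zero fun σ _ => Finset.sum_eq_zero fun t _ => hz r σ t (fun h => h.1 hr)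
  rw [hoct]
  -- compare with `MAIN a − MAIN b`
  have eR : MAIN s B₁ B₂ B₃ (a : ZMod s) - MAIN s B₁ B₂ B₃ (b : ZMod s) =
      ((s : ℂ)⁻¹) ^ 3 * ∑ r ∈ NZ, ∑ σ ∈ NZ, ∑ t ∈ NZ,
        ((∑ m ∈ B₁, (ZMod.stdAddChar (r * (m : ZMod s)) : ℂ)) *
          (∑ m ∈ B₂, (ZMod.stdAddChar (σ * (m : ZMod s)) : ℂ)) * (∑ m ∈ B₃, (ZMod.stdAddChar (t * (m : ZMod s)) : ℂ))) *
          Δ r σ t := by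
    simp only [MAIN, boxG]
    rw [← mul_sub, ← Finset.sum_sub_distrib]
    refine congrArg _ (Finset.sum_congr rfl fun r _ => ?_)
    rw [← Finset.sum_sub_distrib]
    refine Finset.sum_congr rfl fun σ _ => ?_
    rw [← Finset.sum_sub_distrib]
    refine Finset.sum_congr rfl fun t _ => ?_
    simp only [hΔ]; ring
  have eL : (s : ℂ)⁻¹ * ∑ r ∈ NZ, ∑ σ ∈ NZ, ∑ t ∈ NZ,
      ((s : ℂ)⁻¹) ^ 2 * ((∑ m ∈ B₁, (ZMod.stdAddChar (r * (m : ZMod s)) : ℂ)) *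
        (∑ m ∈ B₂, (ZMod.stdAddChar (σ * (m : ZMod s)) : ℂ)) * (∑ m ∈ B₃, (ZMod.stdAddChar (t * (m : ZMod s)) : ℂ))) * Δ r σ t =
      ((s : ℂ)⁻¹) ^ 3 * ∑ r ∈ NZ, ∑ σ ∈ NZ, ∑ t ∈ NZ,
        ((∑ m ∈ B₁, (ZMod.stdAddChar (r * (m : ZMod s)) : ℂ)) *
          (∑ m ∈ B₂, (ZMod.stdAddChar (σ * (m : ZMod s)) : ℂ)) * (∑ m ∈ B₃, (ZMod.stdAddChar (t * (m : ZMod s)) : ℂ))) *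
          Δ r σ t := by
    symm
    rw [show ((s : ℂ)⁻¹) ^ 3 = (s : ℂ)⁻¹ * ((s : ℂ)⁻¹) ^ 2 by ring, mul_assoc]
    refine congrArg _ ?_
    rw [Finset.mul_sum]
    refine Finset.sum_congr rfl fun r _ => ?_
    rw [Finset.mul_sum]
    refine Finset.sum_congr rfl fun σ _ => ?_
    rw [Finset.mul_sum]
    refine Finset.sum_congr rfl fun t _ => ?_
    ring
  rw [eR]
  exact eL

/-- **`∑_{b unit} g_s(n; b) = 0`**: averaging `g_s` over the reduced classes kills it. [folklore] -/
theorem sum_units_gAP_eq_zero (n : ℕ) :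
    ∑ β ∈ (Finset.univ : Finset (ZMod s)).filter (fun β => IsUnit β), gAP s ((β.val : ℕ) : ℤ) n = 0 := by
  classical
  have hs : 0 < s := Nat.pos_of_ne_zero (NeZero.ne s)
  have hφ : (Nat.totient s : ℝ) ≠ 0 := by exact_mod_cast (Nat.totient_pos.mpr hs).ne'
  simp only [gAP, Int.cast_natCast, ZMod.natCast_zmod_val, Finset.sum_sub_distrib]
  rw [Finset.sum_ite_eq, Finset.sum_const, lemma412_card_filter_isUnit, nsmul_eq_mul]
  by_cases hn : n.Coprime s
  · have hu : IsUnit ((n : ℕ) : ZMod s) := (ZMod.isUnit_iff_coprime n s).mpr hn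
    rw [if_pos hn, if_pos (Finset.mem_filter.mpr ⟨Finset.mem_univ _, hu⟩)]
    field_simp; ring
  · have hu : ¬ IsUnit ((n : ℕ) : ZMod s) := fun h => hn ((ZMod.isUnit_iff_coprime n s).mp h)
    rw [if_neg hn, if_neg (fun h => hu (Finset.mem_filter.mp h).2)]
    simp

/-- **The `N₁`-trick** (HB §4: "`N₁` is independent of `a`; we therefore obtain `N − N₁ ≪ …`"): if
`‖MAIN(β)‖ ≤ B` for every unit `β`, then `|∑_{B₁×B₂×B₃} g_s(uvw; a)| ≤ 2B`.
[cite: HeathBrown1986d3, §4 p.41] -/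
theorem abs_boxSum_gAP_le_of_MAIN {a : ℤ} (ha : IsUnit (a : ZMod s)) (B₁ B₂ B₃ : Finset ℕ)
    (hB₁ : ∀ u ∈ B₁, 1 ≤ u) {B : ℝ} (hM : ∀ β : ZMod s, IsUnit β → ‖MAIN s B₁ B₂ B₃ β‖ ≤ B) :
    |∑ u ∈ B₁, ∑ v ∈ B₂, ∑ w ∈ B₃, gAP s a (u * v * w)| ≤ 2 * B := by
  classical
  have hs : 0 < s := Nat.pos_of_ne_zero (NeZero.ne s)
  have hφ0 : (0 : ℝ) < Nat.totient s := by exact_mod_cast Nat.totient_pos.mpr hs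
  set U := (Finset.univ : Finset (ZMod s)).filter (fun β => IsUnit β) with hU
  have hUcard : (U.card : ℝ) = Nat.totient s := by rw [hU, lemma412_card_filter_isUnit]
  set T : ℤ → ℂ := fun b => (((∑ u ∈ B₁, ∑ v ∈ B₂, ∑ w ∈ B₃, gAP s b (u * v * w) : ℝ)) : ℂ) with hT
  have hB0 : 0 ≤ B := (norm_nonneg _).trans (hM (a : ZMod s) ha)
  -- the average of `T` over the units vanishes
  have havg : ∑ β ∈ U, T ((β.val : ℕ) : ℤ) = 0 := by
    simp only [hT]
    rw [← Complex.ofReal_sum]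
    norm_cast
    rw [Finset.sum_comm]
    refine Finset.sum_eq_zero fun u _ => ?_
    rw [Finset.sum_comm]
    refine Finset.sum_eq_zero fun v _ => ?_
    rw [Finset.sum_comm]
    exact Finset.sum_eq_zero fun w _ => sum_units_gAP_eq_zero _
  -- `φ(s) T(a) = ∑_β (MAIN(a) − MAIN(β))`
  have hkey : (U.card : ℂ) * T a = ∑ β ∈ U, (MAIN s B₁ B₂ B₃ (a : ZMod s) - MAIN s B₁ B₂ B₃ β) := by
    have e1 : (U.card : ℂ) * T a = ∑ β ∈ U, (T a - T ((β.val : ℕ) : ℤ)) + ∑ β ∈ U, T ((β.val : ℕ) : ℤ) := by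
      rw [Finset.sum_sub_distrib, sub_add_cancel, Finset.sum_const, nsmul_eq_mul]
    rw [e1, havg, add_zero]
    refine Finset.sum_congr rfl fun β hβ => ?_
    have hβu : IsUnit β := (Finset.mem_filter.mp hβ).2
    have hcast : ((((β.val : ℕ) : ℤ)) : ZMod s) = β := by rw [Int.cast_natCast, ZMod.natCast_zmod_val]
    have hb : IsUnit ((((β.val : ℕ) : ℤ)) : ZMod s) := by rw [hcast]; exact hβu
    have := boxSum_gAP_sub ha hb B₁ B₂ B₃ hB₁
    simp only [hT]
    rw [this, hcast]
  -- norms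
  have habs : |∑ u ∈ B₁, ∑ v ∈ B₂, ∑ w ∈ B₃, gAP s a (u * v * w)| = ‖T a‖ := by
    simp only [hT]; rw [Complex.norm_real, Real.norm_eq_abs]
  rw [habs]
  have hnorm : (Nat.totient s : ℝ) * ‖T a‖ ≤ (Nat.totient s : ℝ) * (2 * B) := by
    calc (Nat.totient s : ℝ) * ‖T a‖ = ‖(U.card : ℂ) * T a‖ := by
          rw [norm_mul, Complex.norm_natCast, hUcard]
      _ = ‖∑ β ∈ U, (MAIN s B₁ B₂ B₃ (a : ZMod s) - MAIN s B₁ B₂ B₃ β)‖ := by rw [hkey]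
      _ ≤ ∑ β ∈ U, ‖MAIN s B₁ B₂ B₃ (a : ZMod s) - MAIN s B₁ B₂ B₃ β‖ := norm_sum_le _ _
      _ ≤ ∑ _β ∈ U, (2 * B) := by
          refine Finset.sum_le_sum fun β hβ => ?_
          have hβu : IsUnit β := (Finset.mem_filter.mp hβ).2
          calc ‖MAIN s B₁ B₂ B₃ (a : ZMod s) - MAIN s B₁ B₂ B₃ β‖
              ≤ ‖MAIN s B₁ B₂ B₃ (a : ZMod s)‖ + ‖MAIN s B₁ B₂ B₃ β‖ := norm_sub_le _ _
            _ ≤ B + B := add_le_add (hM _ ha) (hM β hβu)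
            _ = 2 * B := by ring
      _ = (Nat.totient s : ℝ) * (2 * B) := by rw [Finset.sum_const, nsmul_eq_mul, hUcard]
  exact le_of_mul_le_mul_left hnorm hφ0

/-! ### `MAIN` in the form of the core lemma: removing the `mod D` twist -/

/-- Multiplication by a unit permutes the nonzero residues. [folklore] -/
theorem sum_ne_zero_comp_unit_mul {u : ZMod s} (hu : IsUnit u) (f : ZMod s → ℂ) :
    ∑ x ∈ (Finset.univ : Finset (ZMod s)).filter (fun x => x ≠ 0), f (u * x) =
      ∑ x ∈ (Finset.univ : Finset (ZMod s)).filter (fun x => x ≠ 0), f x := by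
  classical
  obtain ⟨w, rfl⟩ := hu
  refine Finset.sum_nbij' (fun x => (w : ZMod s) * x) (fun y => ((w⁻¹ : (ZMod s)ˣ) : ZMod s) * y)
    (fun x hx => ?_) (fun y hy => ?_) (fun x _ => ?_) (fun y _ => ?_) (fun x _ => rfl)
  · rw [Finset.mem_filter] at hx ⊢
    exact ⟨Finset.mem_univ _, fun h => hx.2 (by simpa using congrArg (fun z => ((w⁻¹ : (ZMod s)ˣ) : ZMod s) * z) h)⟩
  · rw [Finset.mem_filter] at hy ⊢
    exact ⟨Finset.mem_univ _, fun h => hy.2 (by simpa using congrArg (fun z => ((w : (ZMod s)ˣ) : ZMod s) * z) h)⟩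
  · rw [← mul_assoc, Units.inv_mul, one_mul]
  · rw [← mul_assoc, Units.mul_inv, one_mul]

/-- **`MAIN(β)` in core form**: with `D̄ = D⁻¹ (mod s)`, `F₁(r) = G₁(−D̄r)`, `F₂(σ) = G₂(−D̄σ)`,
`F₃(t) = G₃(−D̄t)` and the unit `a'' = β D̄³`,
`MAIN(β) = s⁻³ ∑_{r,σ,t ≠ 0} K₂(r, σ, a''t) F₁(r) F₂(σ) F₃(t)` (substitute `r ↦ −D̄r` etc. and use
`K₂(D̄r, D̄σ, c) = K₂(r, σ, D̄²c)`). [cite: HeathBrown1986d3, §4 p.41 & §7 (classes `mod D`)] -/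
theorem MAIN_eq_core {D : ℕ} (hDs : D.Coprime s) (B₁ B₂ B₃ : Finset ℕ) (β : ZMod s) :
    MAIN s B₁ B₂ B₃ β =
      ((s : ℂ)⁻¹) ^ 3 * ∑ r ∈ (Finset.univ : Finset (ZMod s)).filter (fun r => r ≠ 0),
        ∑ σ ∈ (Finset.univ : Finset (ZMod s)).filter (fun σ => σ ≠ 0),
          ∑ t ∈ (Finset.univ : Finset (ZMod s)).filter (fun t => t ≠ 0),
            K2 s r σ ((β * ((D : ZMod s))⁻¹ ^ 3) * t) *
              (boxG s B₁ (-((D : ZMod s))⁻¹ * r) * boxG s B₂ (-((D : ZMod s))⁻¹ * σ) *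
                boxG s B₃ (-((D : ZMod s))⁻¹ * t)) := by
  classical
  set Di : ZMod s := ((D : ZMod s))⁻¹ with hDi
  have hDu : IsUnit (D : ZMod s) := (ZMod.isUnit_iff_coprime D s).mpr hDs
  have hDiu : IsUnit Di := by
    refine ⟨⟨Di, (D : ZMod s), ZMod.inv_mul_of_unit _ hDu, ZMod.mul_inv_of_unit _ hDu⟩, rfl⟩
  have hu : IsUnit (-Di) := hDiu.neg
  unfold MAIN
  refine congrArg _ ?_
  -- reindex `r`, `σ`, `t` by `x ↦ (−D̄) x`
  rw [← sum_ne_zero_comp_unit_mul hu]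
  refine Finset.sum_congr rfl fun r _ => ?_
  rw [← sum_ne_zero_comp_unit_mul hu]
  refine Finset.sum_congr rfl fun σ _ => ?_
  rw [← sum_ne_zero_comp_unit_mul hu]
  refine Finset.sum_congr rfl fun t _ => ?_
  have hK : K2 s (-(-Di * r)) (-(-Di * σ)) (-(-Di * t) * β) = K2 s r σ ((β * Di ^ 3) * t) := by
    rw [show -(-Di * r) = r * Di by ring, show -(-Di * σ) = σ * Di by ring, K2_scale_units hDiu hDiu,
      show Di * Di * (-(-Di * t) * β) = (β * Di ^ 3) * t by ring]
  rw [hK]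
  ring

/-- **Bounds for the twisted box transforms**: for a class `mod D` of an interval `(L, R]` and
`r ≠ 0`, `‖G(−D̄ r)‖ ≤ min(#box, s/(2 d0 r))`. [folklore] -/
theorem norm_boxG_twist_le {D : ℕ} (hD : 0 < D) (hDs : D.Coprime s) (L R : ℕ) (t₀ : ℤ) {r : ZMod s} (hr : r ≠ 0) :
    ‖boxG s ((Finset.Ioc L R).filter (fun m : ℕ => (m : ZMod D) = (t₀ : ZMod D))) (-((D : ZMod s))⁻¹ * r)‖ ≤
      min ((((Finset.Ioc L R).filter (fun m : ℕ => (m : ZMod D) = (t₀ : ZMod D))).card : ℝ))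
        ((s : ℝ) / (2 * d0 r)) := by
  have hs0 : (0 : ℝ) < s := by exact_mod_cast Nat.pos_of_ne_zero (NeZero.ne s)
  have hDu : IsUnit (D : ZMod s) := (ZMod.isUnit_iff_coprime D s).mpr hDs
  unfold boxG
  refine le_min ?_ ?_
  · refine (norm_sum_le _ _).trans (le_of_eq ?_)
    rw [Finset.sum_congr rfl (fun m _ => AddChar.norm_apply _ _), Finset.sum_const, nsmul_eq_mul, mul_one]
  · have hne : -((D : ZMod s))⁻¹ * r ≠ 0 := by
      intro h
      apply hr
      have h2 := congrArg (fun z => -(D : ZMod s) * z) h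
      simp only [mul_zero] at h2
      rw [← h2]
      rw [← mul_assoc, show -(D : ZMod s) * -((D : ZMod s))⁻¹ = (D : ZMod s) * ((D : ZMod s))⁻¹ by ring,
        ZMod.mul_inv_of_unit _ hDu, one_mul]
    refine (norm_sum_box_stdAddChar_le hD hDs L R t₀ hne).trans ?_
    have e : -((D : ZMod s))⁻¹ * r * (D : ZMod s) = -r := by
      rw [show -((D : ZMod s))⁻¹ * r * (D : ZMod s) = -(r * ((D : ZMod s) * ((D : ZMod s))⁻¹)) by ring,
        ZMod.mul_inv_of_unit _ hDu, mul_one]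
    rw [e]
    have hd0 : (0 : ℝ) < d0 (-r) := by exact_mod_cast d0_pos (neg_ne_zero.mpr hr)
    have hdist : (d0 (-r) : ℝ) / s ≤ distInt ((((-r).val : ℕ) : ℝ) / s) := d0_div_le_distInt (-r)
    rw [d0_neg] at hd0 hdist
    rw [div_le_div_iff₀ (by linarith [div_pos hd0 hs0]) (by positivity)]
    calc 1 * (2 * (d0 r : ℝ)) = 2 * ((d0 r : ℝ) / s) * s := by field_simp
      _ ≤ 2 * distInt ((((-r).val : ℕ) : ℝ) / s) * s := by gcongr
      _ = s * (2 * distInt ((((-r).val : ℕ) : ℝ) / s)) := by ring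

end Main



/-! ### Assembly: the principal estimate for the box sum of `g_s`, modulo Lemma 4 (abstract) and Deligne -/

section Assembly

variable {s : ℕ} [NeZero s]

/-- **Heath-Brown's Lemma 5 for the box sum of `g_s`** (principal estimate), conditional on an
abstract Lemma-4 bound `|S(k,t;ρ,σ;s)| ≤ A₄ · L4shape` and on Deligne's prime bound for `K₂`:
for `(a, s) = 1`, `(D, s) = 1`, three classes `mod D` of intervals `B₁, B₂, B₃` with `#Bᵢ ≤ I, J, K`,
and `maxd ≥ d(h)` (`h ≤ s²`),
`|∑_{B₁×B₂×B₃} g_s(uvw; a)| ≤ 2 s⁻³ · 4 (log₂ s + 1)³ 64^{ω(s)} · W(s; I, J, K, A₄, d(s)(1+log s), (s d₃(s))², maxd)`.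
[cite: HeathBrown1986d3, Lemma 5, §4] -/
theorem abs_boxSum_gAP_le_principal {D : ℕ} (hD : 0 < D) (hDs : D.Coprime s) {a : ℤ} (ha : IsUnit (a : ZMod s))
    {A₄ : ℝ} (hA₄ : 0 ≤ A₄)
    (hL4 : ∀ k t₁ t₂ ρ σ : ℤ, ‖SS s (k : ZMod s) (t₁ : ZMod s) (t₂ : ZMod s) (ρ : ZMod s) (σ : ZMod s)‖ ≤
      A₄ * L4shape s k t₁ t₂ ρ σ)
    (hDel : ∀ (p : ℕ) [Fact p.Prime] (a₁ a₂ a₃ : ZMod p), a₁ ≠ 0 → a₂ ≠ 0 → a₃ ≠ 0 → ‖K2 p a₁ a₂ a₃‖ ≤ 3 * p)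
    (L₁ R₁ L₂ R₂ L₃ R₃ : ℕ) (t₁ t₂ t₃ : ℤ) {I J K maxd : ℝ}
    (hI : ((((Finset.Ioc L₁ R₁).filter (fun m : ℕ => (m : ZMod D) = (t₁ : ZMod D))).card : ℝ)) ≤ I)
    (hJ : ((((Finset.Ioc L₂ R₂).filter (fun m : ℕ => (m : ZMod D) = (t₂ : ZMod D))).card : ℝ)) ≤ J)
    (hK : ((((Finset.Ioc L₃ R₃).filter (fun m : ℕ => (m : ZMod D) = (t₃ : ZMod D))).card : ℝ)) ≤ K)
    (hmaxd : ∀ h : ℕ, h ≤ s ^ 2 → ((Nat.divisors h).card : ℝ) ≤ maxd) :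
    |∑ u ∈ (Finset.Ioc L₁ R₁).filter (fun m : ℕ => (m : ZMod D) = (t₁ : ZMod D)),
        ∑ v ∈ (Finset.Ioc L₂ R₂).filter (fun m : ℕ => (m : ZMod D) = (t₂ : ZMod D)),
          ∑ w ∈ (Finset.Ioc L₃ R₃).filter (fun m : ℕ => (m : ZMod D) = (t₃ : ZMod D)),
            gAP s a (u * v * w)| ≤
      2 * (((s : ℝ)⁻¹) ^ 3 * (4 * ((Nat.log 2 s + 1 : ℕ) : ℝ) ^ 3 * 64 ^ s.primeFactors.card *
        Wconst s I J K A₄ ((Nat.divisors s).card * (1 + Real.log s)) (((s : ℝ) * d3 s) ^ 2) maxd)) := by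
  classical
  have hs : 0 < s := Nat.pos_of_ne_zero (NeZero.ne s)
  have hsR : (0 : ℝ) < s := by exact_mod_cast hs
  have hs1 : (1 : ℝ) ≤ s := by exact_mod_cast hs
  set box₁ := (Finset.Ioc L₁ R₁).filter (fun m : ℕ => (m : ZMod D) = (t₁ : ZMod D)) with hbox₁
  set box₂ := (Finset.Ioc L₂ R₂).filter (fun m : ℕ => (m : ZMod D) = (t₂ : ZMod D)) with hbox₂
  set box₃ := (Finset.Ioc L₃ R₃).filter (fun m : ℕ => (m : ZMod D) = (t₃ : ZMod D)) with hbox₃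
  have hbox₁1 : ∀ u ∈ box₁, 1 ≤ u := fun u hu => by
    have := (Finset.mem_Ioc.mp (Finset.mem_filter.mp hu).1).1; omega
  have hI0 : 0 ≤ I := (Nat.cast_nonneg _).trans hI
  have hJ0 : 0 ≤ J := (Nat.cast_nonneg _).trans hJ
  have hK0 : 0 ≤ K := (Nat.cast_nonneg _).trans hK
  set Lc : ℝ := (Nat.divisors s).card * (1 + Real.log s) with hLc
  set Mc : ℝ := ((s : ℝ) * d3 s) ^ 2 with hMc
  have hLc0 : 0 ≤ Lc := by
    have := Real.log_nonneg hs1; positivity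
  have hMc0 : 0 ≤ Mc := sq_nonneg _
  refine abs_boxSum_gAP_le_of_MAIN ha box₁ box₂ box₃ hbox₁1 fun β hβ => ?_
  rw [MAIN_eq_core hDs box₁ box₂ box₃ β, norm_mul, norm_pow, norm_inv, Complex.norm_natCast]
  refine mul_le_mul_of_nonneg_left ?_ (by positivity)
  -- the unit `a'' = β D̄³`
  have hDu : IsUnit (D : ZMod s) := (ZMod.isUnit_iff_coprime D s).mpr hDs
  have hDiu : IsUnit ((D : ZMod s))⁻¹ :=
    ⟨⟨((D : ZMod s))⁻¹, (D : ZMod s), ZMod.inv_mul_of_unit _ hDu, ZMod.mul_inv_of_unit _ hDu⟩, rfl⟩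
  have ha'' : IsUnit (β * ((D : ZMod s))⁻¹ ^ 3) := hβ.mul (hDiu.pow 3)
  -- the `F`-bounds
  have hF : ∀ (L R : ℕ) (t₀ : ℤ) (X : ℝ),
      ((((Finset.Ioc L R).filter (fun m : ℕ => (m : ZMod D) = (t₀ : ZMod D))).card : ℝ)) ≤ X →
      ∀ r : ZMod s, r ≠ 0 →
        ‖boxG s ((Finset.Ioc L R).filter (fun m : ℕ => (m : ZMod D) = (t₀ : ZMod D))) (-((D : ZMod s))⁻¹ * r)‖ ≤
          min X ((s : ℝ) / d0 r) := by
    intro L R t₀ X hX r hr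
    refine (norm_boxG_twist_le hD hDs L R t₀ hr).trans (min_le_min hX ?_)
    have hd : (0 : ℝ) < d0 r := by exact_mod_cast d0_pos hr
    rw [div_le_div_iff₀ (by positivity) hd]
    nlinarith
  refine core_lemma5 (β * ((D : ZMod s))⁻¹ ^ 3)
    (fun r => boxG s box₁ (-((D : ZMod s))⁻¹ * r)) (fun σ => boxG s box₂ (-((D : ZMod s))⁻¹ * σ))
    (fun t => boxG s box₃ (-((D : ZMod s))⁻¹ * t)) hI0 hJ0 hK0 hA₄ hLc0 hMc0
    (hF L₁ R₁ t₁ I hI) (hF L₂ R₂ t₂ J hJ) (hF L₃ R₃ t₃ K hK) hmaxd ?_ ?_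
  · -- `hoff` from the abstract Lemma 4
    intro i j ρt σt _ _ u₁ u₂ hne
    have h := KK_bound_of_L4 hA₄ hL4 ha'' ρt σt u₁ u₂ (H2 i j ρt σt)
    unfold KK Hset ug offW
    exact h
  · -- `hdiag` from Deligne
    intro ρt σt c
    have h := K2_sq_le_of_deligne hDel ρt σt c
    unfold ug
    rw [hMc]
    exact h

end Assembly

/-! ## T4: Fouvry–Tenenbaum Lemma 4.13 at `θ = 1/2 + 1/85` from the three estimates

Numerology first (pure real inequalities), then the assembly. Constants: `θ = 87/170`,
`δ = 10⁻⁴`, `η ≤ 10⁻⁵`. -/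

section Numerology

omit [NeZero q]

/-- `s^e ≤ x^{θ e}` for `1 ≤ s ≤ x^θ`, `e ≥ 0`. [folklore] -/
theorem spow_le {s x θ e : ℝ} (hs : 0 ≤ s) (hx : 0 ≤ x) (hsx : s ≤ x ^ θ) (he : 0 ≤ e) :
    s ^ e ≤ x ^ (θ * e) := by
  calc s ^ e ≤ (x ^ θ) ^ e := Real.rpow_le_rpow hs hsx he
    _ = x ^ (θ * e) := by rw [← Real.rpow_mul hx]

/-- **Case A numerology** (`M₁ ≤ x^{23/100}`, estimate `E₂`):
`10 M₁M₂ dL + 2 M₁ d² L² s^{3/2} ≤ 12 Cτ² c₁² x^{1−δ}`. [folklore] -/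
theorem num_caseA {x s M₁ M₂ d L Cτ c₁ η : ℝ} (hx : 1 ≤ x) (hs : 1 ≤ s) (hsx : s ≤ x ^ (87 / 170 : ℝ))
    (hη0 : 0 ≤ η) (hη : η ≤ 1 / 100000)
    (hM₁ : M₁ ≤ x ^ (23 / 100 : ℝ)) (hM12 : M₁ * M₂ ≤ x ^ (2 / 3 : ℝ))
    (hCτ : 1 ≤ Cτ) (hc₁ : 1 ≤ c₁) (hd0 : 0 ≤ d) (hd : d ≤ Cτ * s ^ η) (hL0 : 0 ≤ L) (hL : L ≤ c₁ * s ^ η) :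
    10 * (M₁ * M₂) * (d * L) + 2 * M₁ * (d ^ 2 * L ^ 2) * s ^ (3 / 2 : ℝ) ≤
      12 * Cτ ^ 2 * c₁ ^ 2 * x ^ (1 - 1 / 10000 : ℝ) := by
  have hx0 : 0 < x := by linarith
  have hs0 : 0 < s := by linarith
  have hθ0 : (0 : ℝ) ≤ 87 / 170 := by norm_num
  have hdL : d * L ≤ Cτ * c₁ * s ^ (2 * η) := by
    calc d * L ≤ (Cτ * s ^ η) * (c₁ * s ^ η) := mul_le_mul hd hL hL0 (by positivity)
      _ = Cτ * c₁ * (s ^ η * s ^ η) := by ring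
      _ = Cτ * c₁ * s ^ (2 * η) := by rw [← Real.rpow_add hs0]; ring_nf
  have hdL2 : d ^ 2 * L ^ 2 ≤ (Cτ * c₁) ^ 2 * s ^ (4 * η) := by
    have := pow_le_pow_left₀ (mul_nonneg hd0 hL0) hdL 2
    calc d ^ 2 * L ^ 2 = (d * L) ^ 2 := by ring
      _ ≤ (Cτ * c₁ * s ^ (2 * η)) ^ 2 := this
      _ = (Cτ * c₁) ^ 2 * (s ^ (2 * η) * s ^ (2 * η)) := by ring
      _ = (Cτ * c₁) ^ 2 * s ^ (4 * η) := by rw [← Real.rpow_add hs0]; ring_nf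
  have hxpow : ∀ e : ℝ, e ≤ 1 - 1 / 10000 → x ^ e ≤ x ^ (1 - 1 / 10000 : ℝ) := fun e he =>
    Real.rpow_le_rpow_of_exponent_le hx he
  -- term 1
  have h1 : 10 * (M₁ * M₂) * (d * L) ≤ 10 * Cτ ^ 2 * c₁ ^ 2 * x ^ (1 - 1 / 10000 : ℝ) := by
    have hs2η : s ^ (2 * η) ≤ x ^ ((87 / 170 : ℝ) * (2 * η)) := spow_le hs0.le hx0.le hsx (by positivity)
    calc 10 * (M₁ * M₂) * (d * L) ≤ 10 * x ^ (2 / 3 : ℝ) * (Cτ * c₁ * s ^ (2 * η)) :=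
          mul_le_mul (mul_le_mul_of_nonneg_left hM12 (by norm_num)) hdL (by positivity) (by positivity)
      _ ≤ 10 * x ^ (2 / 3 : ℝ) * (Cτ * c₁ * x ^ ((87 / 170 : ℝ) * (2 * η))) := by gcongr
      _ = 10 * (Cτ * c₁) * (x ^ (2 / 3 : ℝ) * x ^ ((87 / 170 : ℝ) * (2 * η))) := by ring
      _ = 10 * (Cτ * c₁) * x ^ (2 / 3 + (87 / 170 : ℝ) * (2 * η)) := by rw [← Real.rpow_add hx0]
      _ ≤ 10 * (Cτ * c₁) * x ^ (1 - 1 / 10000 : ℝ) := by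
          refine mul_le_mul_of_nonneg_left (hxpow _ ?_) (by positivity)
          nlinarith
      _ ≤ 10 * Cτ ^ 2 * c₁ ^ 2 * x ^ (1 - 1 / 10000 : ℝ) := by
          have hP1 : 1 ≤ Cτ * c₁ := by nlinarith
          have : Cτ * c₁ ≤ Cτ ^ 2 * c₁ ^ 2 := by
            calc Cτ * c₁ = (Cτ * c₁) * 1 := by ring
              _ ≤ (Cτ * c₁) * (Cτ * c₁) := by gcongr
              _ = Cτ ^ 2 * c₁ ^ 2 := by ring
          have hxp : 0 ≤ x ^ (1 - 1 / 10000 : ℝ) := by positivity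
          nlinarith
  -- term 2
  have h2 : 2 * M₁ * (d ^ 2 * L ^ 2) * s ^ (3 / 2 : ℝ) ≤ 2 * Cτ ^ 2 * c₁ ^ 2 * x ^ (1 - 1 / 10000 : ℝ) := by
    have hs32 : s ^ (4 * η) * s ^ (3 / 2 : ℝ) ≤ x ^ ((87 / 170 : ℝ) * (4 * η + 3 / 2)) := by
      rw [← Real.rpow_add hs0]; exact spow_le hs0.le hx0.le hsx (by positivity)
    calc 2 * M₁ * (d ^ 2 * L ^ 2) * s ^ (3 / 2 : ℝ)
        ≤ 2 * x ^ (23 / 100 : ℝ) * ((Cτ * c₁) ^ 2 * s ^ (4 * η)) * s ^ (3 / 2 : ℝ) := by gcongr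
      _ = 2 * (Cτ * c₁) ^ 2 * (x ^ (23 / 100 : ℝ) * (s ^ (4 * η) * s ^ (3 / 2 : ℝ))) := by ring
      _ ≤ 2 * (Cτ * c₁) ^ 2 * (x ^ (23 / 100 : ℝ) * x ^ ((87 / 170 : ℝ) * (4 * η + 3 / 2))) := by gcongr
      _ = 2 * (Cτ * c₁) ^ 2 * x ^ (23 / 100 + (87 / 170 : ℝ) * (4 * η + 3 / 2)) := by rw [← Real.rpow_add hx0]
      _ ≤ 2 * (Cτ * c₁) ^ 2 * x ^ (1 - 1 / 10000 : ℝ) := by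
          refine mul_le_mul_of_nonneg_left (hxpow _ ?_) (by positivity)
          nlinarith
      _ = 2 * Cτ ^ 2 * c₁ ^ 2 * x ^ (1 - 1 / 10000 : ℝ) := by ring
  linarith

set_option maxHeartbeats 800000 in
/-- **Case B numerology** (`M₃ ≤ x^{0.4637}`, estimate `E₁` = Lemma 5 with `K = 2M₃`). [folklore] -/
theorem num_caseB {Cτ c₁ CL cL η : ℝ} (hCτ : 1 ≤ Cτ) (hc₁ : 1 ≤ c₁) (hCL : 0 ≤ CL) (hcL : 0 ≤ cL)
    (hη0 : 0 ≤ η) (hη : η ≤ 1 / 100000) (hηcL : η * cL ≤ 1 / 100000) :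
    ∃ CB : ℝ, 0 ≤ CB ∧ ∀ x s M₁ M₂ M₃ d L ℓ G d₃ : ℝ, 1 ≤ x → 1 ≤ s → s ≤ x ^ (87 / 170 : ℝ) →
      0 ≤ M₁ → 0 ≤ M₂ → M₁ * M₂ ≤ x ^ (2 / 3 : ℝ) → 0 ≤ M₃ → M₃ ≤ x ^ (4637 / 10000 : ℝ) →
      1 ≤ d → d ≤ Cτ * s ^ η → 0 ≤ L → L ≤ c₁ * s ^ η → 0 ≤ ℓ → ℓ ≤ 2 * L → 0 ≤ G → G ≤ d ^ 6 →
      0 ≤ d₃ → d₃ ≤ d ^ 2 →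
      s * (2 * (((s : ℝ)⁻¹) ^ 3 * (4 * ℓ ^ 3 * G *
        (Real.sqrt (Cτ * (s ^ 2) ^ η) *
          (32 * Real.sqrt ((CL * d ^ cL * s ^ (5 / 2 : ℝ)) * s ^ (-(5 / 6 : ℝ))) * d * s ^ 3 +
            12 * Real.sqrt ((CL * d ^ cL * s ^ (5 / 2 : ℝ)) * (d * L)) * d * s ^ 2 * Real.sqrt ((2 * M₁) * (2 * M₂)) +
            12 * Real.sqrt ((s * d₃) ^ 2) * Real.sqrt (2 * M₃) * (s ^ 2 * Real.sqrt s)))))) ≤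
        CB * x ^ (1 - 1 / 10000 : ℝ) := by
  set cP : ℝ := 64 * c₁ ^ 3 * Cτ ^ 7 with hcP
  set TA : ℝ := cP * (32 * (Real.sqrt CL * Cτ ^ (cL / 2)) * Cτ) with hTA
  set TB : ℝ := cP * (12 * (Real.sqrt CL * Cτ ^ (cL / 2) * Real.sqrt (Cτ * c₁)) * Cτ * 2) with hTB
  set TC : ℝ := cP * (12 * Cτ ^ 2 * Real.sqrt 2) with hTC
  have hCτ0 : 0 ≤ Cτ := by linarith
  refine ⟨TA + TB + TC, by positivity, ?_⟩
  intro x s M₁ M₂ M₃ d L ℓ G d₃ hx hs hsx hM₁0 hM₂0 hM12 hM₃0 hM₃ hd1 hd hL0 hL hℓ0 hℓ hG0 hG hd₃0 hd₃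
  have hx0 : 0 < x := by linarith
  have hs0 : 0 < s := by linarith
  have hd0 : 0 ≤ d := by linarith
  have hθ : (0 : ℝ) ≤ 87 / 170 := by norm_num
  have hxpow : ∀ e : ℝ, e ≤ 1 - 1 / 10000 → x ^ e ≤ x ^ (1 - 1 / 10000 : ℝ) := fun e he =>
    Real.rpow_le_rpow_of_exponent_le hx he
  have hsη : ∀ e : ℝ, 0 ≤ e → (1 : ℝ) ≤ s ^ e := fun e he => Real.one_le_rpow hs he
  -- Step 0: algebra — cancel the powers of `s`
  have hs_ne : (s : ℝ) ≠ 0 := hs0.ne'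
  have halg : s * (2 * (((s : ℝ)⁻¹) ^ 3 * (4 * ℓ ^ 3 * G *
        (Real.sqrt (Cτ * (s ^ 2) ^ η) *
          (32 * Real.sqrt ((CL * d ^ cL * s ^ (5 / 2 : ℝ)) * s ^ (-(5 / 6 : ℝ))) * d * s ^ 3 +
            12 * Real.sqrt ((CL * d ^ cL * s ^ (5 / 2 : ℝ)) * (d * L)) * d * s ^ 2 * Real.sqrt ((2 * M₁) * (2 * M₂)) +
            12 * Real.sqrt ((s * d₃) ^ 2) * Real.sqrt (2 * M₃) * (s ^ 2 * Real.sqrt s)))))) =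
      (8 * ℓ ^ 3 * G * Real.sqrt (Cτ * (s ^ 2) ^ η)) *
        (32 * Real.sqrt ((CL * d ^ cL * s ^ (5 / 2 : ℝ)) * s ^ (-(5 / 6 : ℝ))) * d * s +
          12 * Real.sqrt ((CL * d ^ cL * s ^ (5 / 2 : ℝ)) * (d * L)) * d * Real.sqrt ((2 * M₁) * (2 * M₂)) +
          12 * d₃ * Real.sqrt (2 * M₃) * (s * Real.sqrt s)) := by
    rw [Real.sqrt_sq (by positivity)]
    field_simp
    ring
  rw [halg]
  -- Step 1: the prefactor `P = 8 ℓ³ G √maxd ≤ cP s^{10η}`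
  have hP : 8 * ℓ ^ 3 * G * Real.sqrt (Cτ * (s ^ 2) ^ η) ≤ cP * s ^ (10 * η) := by
    have hℓ3 : ℓ ^ 3 ≤ (2 * (c₁ * s ^ η)) ^ 3 := pow_le_pow_left₀ hℓ0 (hℓ.trans (by linarith)) 3
    have hG' : G ≤ (Cτ * s ^ η) ^ 6 := hG.trans (pow_le_pow_left₀ hd0 hd 6)
    have hsq : Real.sqrt (Cτ * (s ^ 2) ^ η) ≤ Cτ * s ^ η := by
      refine (Real.sqrt_le_left (by positivity)).2 ?_
      rw [← Real.rpow_natCast s 2, ← Real.rpow_mul hs0.le]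
      have hC2 : Cτ ≤ Cτ ^ 2 := by
        calc Cτ = Cτ * 1 := (mul_one _).symm
          _ ≤ Cτ * Cτ := by gcongr
          _ = Cτ ^ 2 := (sq Cτ).symm
      have h1 : Cτ * s ^ ((2 : ℕ) * η) ≤ Cτ ^ 2 * s ^ ((2 : ℕ) * η) :=
        mul_le_mul_of_nonneg_right hC2 (by positivity)
      calc Cτ * s ^ (((2 : ℕ) : ℝ) * η) ≤ Cτ ^ 2 * s ^ (((2 : ℕ) : ℝ) * η) := by exact_mod_cast h1
        _ = (Cτ * s ^ η) ^ 2 := by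
            rw [mul_pow, ← Real.rpow_natCast (s ^ η) 2, ← Real.rpow_mul hs0.le]; push_cast; ring_nf
    calc 8 * ℓ ^ 3 * G * Real.sqrt (Cτ * (s ^ 2) ^ η)
        ≤ 8 * (2 * (c₁ * s ^ η)) ^ 3 * (Cτ * s ^ η) ^ 6 * (Cτ * s ^ η) := by gcongr
      _ = cP * ((s ^ η) ^ 3 * (s ^ η) ^ 6 * s ^ η) := by rw [hcP]; ring
      _ = cP * s ^ (10 * η) := by
          congr 1
          rw [← Real.rpow_natCast (s ^ η) 3, ← Real.rpow_natCast (s ^ η) 6, ← Real.rpow_mul hs0.le,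
            ← Real.rpow_mul hs0.le, ← Real.rpow_add hs0, ← Real.rpow_add hs0]
          push_cast; ring_nf
  have hP0 : 0 ≤ 8 * ℓ ^ 3 * G * Real.sqrt (Cτ * (s ^ 2) ^ η) := by positivity
  -- Step 2: `d^{cL} ≤ Cτ^{cL} s^{η cL}` and the two square roots
  have hdcL : d ^ cL ≤ Cτ ^ cL * s ^ (η * cL) := by
    calc d ^ cL ≤ (Cτ * s ^ η) ^ cL := Real.rpow_le_rpow hd0 hd hcL
      _ = Cτ ^ cL * s ^ (η * cL) := by rw [Real.mul_rpow hCτ0 (by positivity), ← Real.rpow_mul hs0.le]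
  have hsqA : Real.sqrt ((CL * d ^ cL * s ^ (5 / 2 : ℝ)) * s ^ (-(5 / 6 : ℝ))) ≤
      (Real.sqrt CL * Cτ ^ (cL / 2)) * s ^ ((η * cL + 5 / 3) / 2) := by
    refine (Real.sqrt_le_left (by positivity)).2 ?_
    have e1 : ((Real.sqrt CL * Cτ ^ (cL / 2)) * s ^ ((η * cL + 5 / 3) / 2)) ^ 2 =
        CL * (Cτ ^ cL * s ^ (η * cL)) * s ^ (5 / 3 : ℝ) := by
      rw [mul_pow, mul_pow, Real.sq_sqrt hCL, ← Real.rpow_natCast (Cτ ^ (cL / 2)) 2, ← Real.rpow_mul hCτ0,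
        ← Real.rpow_natCast (s ^ ((η * cL + 5 / 3) / 2)) 2, ← Real.rpow_mul hs0.le]
      push_cast
      rw [show cL / 2 * 2 = cL by ring, show (η * cL + 5 / 3) / 2 * 2 = η * cL + 5 / 3 by ring,
        Real.rpow_add hs0]; ring
    rw [e1, mul_assoc (CL * d ^ cL), ← Real.rpow_add hs0, show (5 / 2 : ℝ) + -(5 / 6) = 5 / 3 by norm_num]
    have : CL * d ^ cL ≤ CL * (Cτ ^ cL * s ^ (η * cL)) := mul_le_mul_of_nonneg_left hdcL hCL
    exact mul_le_mul_of_nonneg_right this (by positivity)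
  have hsqB : Real.sqrt ((CL * d ^ cL * s ^ (5 / 2 : ℝ)) * (d * L)) ≤
      (Real.sqrt CL * Cτ ^ (cL / 2) * Real.sqrt (Cτ * c₁)) * s ^ ((η * cL + 5 / 2 + 2 * η) / 2) := by
    refine (Real.sqrt_le_left (by positivity)).2 ?_
    have e1 : ((Real.sqrt CL * Cτ ^ (cL / 2) * Real.sqrt (Cτ * c₁)) * s ^ ((η * cL + 5 / 2 + 2 * η) / 2)) ^ 2 =
        CL * (Cτ ^ cL * s ^ (η * cL)) * s ^ (5 / 2 : ℝ) * ((Cτ * s ^ η) * (c₁ * s ^ η)) := by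
      rw [mul_pow, mul_pow, mul_pow, Real.sq_sqrt hCL, Real.sq_sqrt (by positivity),
        ← Real.rpow_natCast (Cτ ^ (cL / 2)) 2, ← Real.rpow_mul hCτ0,
        ← Real.rpow_natCast (s ^ ((η * cL + 5 / 2 + 2 * η) / 2)) 2, ← Real.rpow_mul hs0.le]
      push_cast
      rw [show cL / 2 * 2 = cL by ring, show (η * cL + 5 / 2 + 2 * η) / 2 * 2 = η * cL + 5 / 2 + η + η by ring,
        Real.rpow_add hs0, Real.rpow_add hs0, Real.rpow_add hs0]; ring
    rw [e1]
    have h1 : CL * d ^ cL * s ^ (5 / 2 : ℝ) ≤ CL * (Cτ ^ cL * s ^ (η * cL)) * s ^ (5 / 2 : ℝ) :=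
      mul_le_mul_of_nonneg_right (mul_le_mul_of_nonneg_left hdcL hCL) (by positivity)
    have h2 : d * L ≤ (Cτ * s ^ η) * (c₁ * s ^ η) := mul_le_mul hd hL hL0 (by positivity)
    exact mul_le_mul h1 h2 (by positivity) (by positivity)
  have hIJ : Real.sqrt ((2 * M₁) * (2 * M₂)) ≤ 2 * x ^ (1 / 3 : ℝ) := by
    refine (Real.sqrt_le_left (by positivity)).2 ?_
    have e23 : x ^ (2 / 3 : ℝ) = (x ^ (1 / 3 : ℝ)) ^ 2 := by
      rw [← Real.rpow_natCast, ← Real.rpow_mul hx0.le]; norm_num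
    calc (2 * M₁) * (2 * M₂) = 4 * (M₁ * M₂) := by ring
      _ ≤ 4 * x ^ (2 / 3 : ℝ) := by linarith
      _ = (2 * x ^ (1 / 3 : ℝ)) ^ 2 := by rw [e23]; ring
  have hK : Real.sqrt (2 * M₃) ≤ Real.sqrt 2 * x ^ ((4637 / 10000 : ℝ) / 2) := by
    rw [Real.sqrt_mul (by norm_num)]
    refine mul_le_mul_of_nonneg_left ?_ (Real.sqrt_nonneg _)
    calc Real.sqrt M₃ ≤ Real.sqrt (x ^ (4637 / 10000 : ℝ)) := Real.sqrt_le_sqrt hM₃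
      _ = x ^ ((4637 / 10000 : ℝ) / 2) := by
          rw [Real.sqrt_eq_rpow, ← Real.rpow_mul hx0.le]; norm_num
  have hd₃' : d₃ ≤ Cτ ^ 2 * s ^ (2 * η) := by
    calc d₃ ≤ d ^ 2 := hd₃
      _ ≤ (Cτ * s ^ η) ^ 2 := pow_le_pow_left₀ hd0 hd 2
      _ = Cτ ^ 2 * s ^ (2 * η) := by
          rw [mul_pow, ← Real.rpow_natCast (s ^ η) 2, ← Real.rpow_mul hs0.le]; push_cast; ring_nf
  -- Step 3: the three terms
  have hsx' : ∀ e : ℝ, 0 ≤ e → s ^ e ≤ x ^ ((87 / 170 : ℝ) * e) := fun e he => spow_le hs0.le hx0.le hsx he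
  have hηcL0 : 0 ≤ η * cL := mul_nonneg hη0 hcL
  have tA : (8 * ℓ ^ 3 * G * Real.sqrt (Cτ * (s ^ 2) ^ η)) *
      (32 * Real.sqrt ((CL * d ^ cL * s ^ (5 / 2 : ℝ)) * s ^ (-(5 / 6 : ℝ))) * d * s) ≤ TA * x ^ (1 - 1 / 10000 : ℝ) := by
    calc (8 * ℓ ^ 3 * G * Real.sqrt (Cτ * (s ^ 2) ^ η)) *
          (32 * Real.sqrt ((CL * d ^ cL * s ^ (5 / 2 : ℝ)) * s ^ (-(5 / 6 : ℝ))) * d * s)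
        ≤ (cP * s ^ (10 * η)) * (32 * ((Real.sqrt CL * Cτ ^ (cL / 2)) * s ^ ((η * cL + 5 / 3) / 2)) * (Cτ * s ^ η) * s) := by
          gcongr
      _ = TA * (s ^ (10 * η) * s ^ ((η * cL + 5 / 3) / 2) * s ^ η * s ^ (1 : ℝ)) := by
          rw [hTA, Real.rpow_one]; ring
      _ = TA * s ^ (10 * η + (η * cL + 5 / 3) / 2 + η + 1) := by
          rw [← Real.rpow_add hs0, ← Real.rpow_add hs0, ← Real.rpow_add hs0]
      _ ≤ TA * x ^ ((87 / 170 : ℝ) * (10 * η + (η * cL + 5 / 3) / 2 + η + 1)) := by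
          refine mul_le_mul_of_nonneg_left (hsx' _ ?_) (by positivity)
          linarith
      _ ≤ TA * x ^ (1 - 1 / 10000 : ℝ) := by
          refine mul_le_mul_of_nonneg_left (hxpow _ ?_) (by positivity)
          linarith
  have tB : (8 * ℓ ^ 3 * G * Real.sqrt (Cτ * (s ^ 2) ^ η)) *
      (12 * Real.sqrt ((CL * d ^ cL * s ^ (5 / 2 : ℝ)) * (d * L)) * d * Real.sqrt ((2 * M₁) * (2 * M₂))) ≤
        TB * x ^ (1 - 1 / 10000 : ℝ) := by
    calc (8 * ℓ ^ 3 * G * Real.sqrt (Cτ * (s ^ 2) ^ η)) *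
          (12 * Real.sqrt ((CL * d ^ cL * s ^ (5 / 2 : ℝ)) * (d * L)) * d * Real.sqrt ((2 * M₁) * (2 * M₂)))
        ≤ (cP * s ^ (10 * η)) * (12 * ((Real.sqrt CL * Cτ ^ (cL / 2) * Real.sqrt (Cτ * c₁)) *
            s ^ ((η * cL + 5 / 2 + 2 * η) / 2)) * (Cτ * s ^ η) * (2 * x ^ (1 / 3 : ℝ))) := by
          gcongr
      _ = TB * ((s ^ (10 * η) * s ^ ((η * cL + 5 / 2 + 2 * η) / 2) * s ^ η) * x ^ (1 / 3 : ℝ)) := by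
          rw [hTB]; ring
      _ = TB * (s ^ (10 * η + (η * cL + 5 / 2 + 2 * η) / 2 + η) * x ^ (1 / 3 : ℝ)) := by
          rw [← Real.rpow_add hs0, ← Real.rpow_add hs0]
      _ ≤ TB * (x ^ ((87 / 170 : ℝ) * (10 * η + (η * cL + 5 / 2 + 2 * η) / 2 + η)) * x ^ (1 / 3 : ℝ)) := by
          refine mul_le_mul_of_nonneg_left (mul_le_mul_of_nonneg_right (hsx' _ ?_) (by positivity)) (by positivity)
          linarith
      _ = TB * x ^ ((87 / 170 : ℝ) * (10 * η + (η * cL + 5 / 2 + 2 * η) / 2 + η) + 1 / 3) := by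
          rw [← Real.rpow_add hx0]
      _ ≤ TB * x ^ (1 - 1 / 10000 : ℝ) := by
          refine mul_le_mul_of_nonneg_left (hxpow _ ?_) (by positivity)
          linarith
  have tC : (8 * ℓ ^ 3 * G * Real.sqrt (Cτ * (s ^ 2) ^ η)) * (12 * d₃ * Real.sqrt (2 * M₃) * (s * Real.sqrt s)) ≤
      TC * x ^ (1 - 1 / 10000 : ℝ) := by
    have hs32 : s * Real.sqrt s = s ^ (3 / 2 : ℝ) := by
      rw [Real.sqrt_eq_rpow, ← Real.rpow_one_add' hs0.le (by norm_num)]; norm_num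
    rw [hs32]
    calc (8 * ℓ ^ 3 * G * Real.sqrt (Cτ * (s ^ 2) ^ η)) * (12 * d₃ * Real.sqrt (2 * M₃) * s ^ (3 / 2 : ℝ))
        ≤ (cP * s ^ (10 * η)) * (12 * (Cτ ^ 2 * s ^ (2 * η)) * (Real.sqrt 2 * x ^ ((4637 / 10000 : ℝ) / 2)) * s ^ (3 / 2 : ℝ)) := by
          gcongr
      _ = TC * ((s ^ (10 * η) * s ^ (2 * η) * s ^ (3 / 2 : ℝ)) * x ^ ((4637 / 10000 : ℝ) / 2)) := by
          rw [hTC]; ring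
      _ = TC * (s ^ (10 * η + 2 * η + 3 / 2) * x ^ ((4637 / 10000 : ℝ) / 2)) := by
          rw [← Real.rpow_add hs0, ← Real.rpow_add hs0]
      _ ≤ TC * (x ^ ((87 / 170 : ℝ) * (10 * η + 2 * η + 3 / 2)) * x ^ ((4637 / 10000 : ℝ) / 2)) := by
          refine mul_le_mul_of_nonneg_left (mul_le_mul_of_nonneg_right (hsx' _ ?_) (by positivity)) (by positivity)
          linarith
      _ = TC * x ^ ((87 / 170 : ℝ) * (10 * η + 2 * η + 3 / 2) + (4637 / 10000 : ℝ) / 2) := by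
          rw [← Real.rpow_add hx0]
      _ ≤ TC * x ^ (1 - 1 / 10000 : ℝ) := by
          refine mul_le_mul_of_nonneg_left (hxpow _ ?_) (by positivity)
          linarith
  calc (8 * ℓ ^ 3 * G * Real.sqrt (Cτ * (s ^ 2) ^ η)) *
        (32 * Real.sqrt ((CL * d ^ cL * s ^ (5 / 2 : ℝ)) * s ^ (-(5 / 6 : ℝ))) * d * s +
          12 * Real.sqrt ((CL * d ^ cL * s ^ (5 / 2 : ℝ)) * (d * L)) * d * Real.sqrt ((2 * M₁) * (2 * M₂)) +
          12 * d₃ * Real.sqrt (2 * M₃) * (s * Real.sqrt s))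
      = (8 * ℓ ^ 3 * G * Real.sqrt (Cτ * (s ^ 2) ^ η)) *
          (32 * Real.sqrt ((CL * d ^ cL * s ^ (5 / 2 : ℝ)) * s ^ (-(5 / 6 : ℝ))) * d * s) +
        (8 * ℓ ^ 3 * G * Real.sqrt (Cτ * (s ^ 2) ^ η)) *
          (12 * Real.sqrt ((CL * d ^ cL * s ^ (5 / 2 : ℝ)) * (d * L)) * d * Real.sqrt ((2 * M₁) * (2 * M₂))) +
        (8 * ℓ ^ 3 * G * Real.sqrt (Cτ * (s ^ 2) ^ η)) * (12 * d₃ * Real.sqrt (2 * M₃) * (s * Real.sqrt s)) := by ring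
    _ ≤ TA * x ^ (1 - 1 / 10000 : ℝ) + TB * x ^ (1 - 1 / 10000 : ℝ) + TC * x ^ (1 - 1 / 10000 : ℝ) :=
        add_le_add (add_le_add tA tB) tC
    _ = (TA + TB + TC) * x ^ (1 - 1 / 10000 : ℝ) := by ring

/-- `T^{1/4} s ≤ Y` when `T s⁴ ≤ Y⁴` (`T, s, Y ≥ 0`). [folklore] -/
theorem rpow_quarter_mul_le {T s Y : ℝ} (hT : 0 ≤ T) (hs : 0 ≤ s) (hY : 0 ≤ Y) (h : T * s ^ 4 ≤ Y ^ 4) :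
    T ^ (1 / 4 : ℝ) * s ≤ Y := by
  have e1 : T ^ (1 / 4 : ℝ) * s = (T * s ^ 4) ^ (1 / 4 : ℝ) := by
    rw [Real.mul_rpow hT (by positivity), ← Real.rpow_natCast s 4, ← Real.rpow_mul hs]; norm_num
  have e2 : Y = (Y ^ 4) ^ (1 / 4 : ℝ) := by
    rw [← Real.rpow_natCast Y 4, ← Real.rpow_mul hY]; norm_num
  rw [e1, e2]
  exact Real.rpow_le_rpow (by positivity) h (by norm_num)

set_option maxHeartbeats 800000 in
/-- **Case C numerology** (`M₁ > x^{0.23}`, `M₃ > x^{0.4637}`; estimate `E₃` = Lemma 7 analogue with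
`v`-box = box 1, `u`-box = box 2, `w`-box = box 3): the fourth-root term times `s`. [folklore] -/
theorem num_caseC {Cτ c₁ C₃ η : ℝ} (hCτ : 1 ≤ Cτ) (hc₁ : 1 ≤ c₁) (hC₃ : 0 ≤ C₃) (hη0 : 0 ≤ η) (hη : η ≤ 1 / 100000) :
    ∃ CC : ℝ, 0 ≤ CC ∧ ∀ x s M₁ M₂ M₃ d L ℓ Mdiv V Jp I R₁ Kp : ℝ, 1 ≤ x → 1 ≤ s → s ≤ x ^ (87 / 170 : ℝ) →
      1 ≤ M₁ → x ^ (23 / 100 : ℝ) ≤ M₁ → M₁ ≤ M₂ → M₂ ≤ M₃ → M₁ * M₂ ≤ x ^ (5363 / 10000 : ℝ) →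
      M₁ * M₂ * M₃ ≤ x → 1 ≤ d → d ≤ Cτ * s ^ η → 0 ≤ L → L ≤ c₁ * s ^ η → 0 ≤ ℓ → ℓ ≤ 2 * L →
      0 ≤ Mdiv → Mdiv ≤ 4 * Cτ * x ^ (2 * η) → 0 ≤ V → V ≤ 4 * M₁ → 0 ≤ Jp → Jp ≤ 3 * M₁ →
      0 ≤ I → I ≤ 2 * M₂ → 0 ≤ R₁ → R₁ ≤ 2 * M₂ → 0 ≤ Kp → Kp ≤ 3 * M₃ →
      (C₃ * (s * V) ^ η * d * Mdiv * L ^ 2 * ℓ ^ 2 * I ^ 3 * (R₁ + Kp) *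
          (Jp ^ 2 * (1 + V ^ 2 / s + V * Real.sqrt V / Real.sqrt s))) ^ (1 / 4 : ℝ) * s ≤
        CC * x ^ (1 - 1 / 10000 : ℝ) := by
  -- the constant: `(loss const) * 360 * (1 + 16 + 8)`, fourth root not taken (we bound the 4th power)
  set cL0 : ℝ := C₃ * 4 ^ η * Cτ * (4 * Cτ) * c₁ ^ 2 * (4 * c₁ ^ 2) with hcL0
  set K4 : ℝ := cL0 * 360 * 25 + 1 with hK4
  have hCτ0 : 0 ≤ Cτ := by linarith
  have hcL00 : 0 ≤ cL0 := by rw [hcL0]; positivity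
  have hK41 : 1 ≤ K4 := by rw [hK4]; nlinarith
  refine ⟨K4, by linarith, ?_⟩
  intro x s M₁ M₂ M₃ d L ℓ Mdiv V Jp I R₁ Kp hx hs hsx hM₁1 hM₁lo h12 h23 hM12 hprod hd1 hd hL0 hL hℓ0 hℓ hMd0 hMd
    hV0 hV hJp0 hJp hI0 hI hR0 hR hKp0 hKp
  have hx0 : 0 < x := by linarith
  have hs0 : 0 < s := by linarith
  have hd0 : 0 ≤ d := by linarith
  have hM₁0 : 0 < M₁ := by linarith
  have hM₂1 : 1 ≤ M₂ := hM₁1.trans h12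
  have hM₂0 : 0 < M₂ := by linarith
  have hM₃0 : 0 ≤ M₃ := hM₂0.le.trans h23
  have hP0 : 0 < M₁ * M₂ := mul_pos hM₁0 hM₂0
  have hxpow : ∀ e : ℝ, e ≤ 399952 / 100000 → x ^ e ≤ x ^ (399952 / 100000 : ℝ) := fun e he =>
    Real.rpow_le_rpow_of_exponent_le hx he
  have hsx' : ∀ e : ℝ, 0 ≤ e → s ^ e ≤ x ^ ((87 / 170 : ℝ) * e) := fun e he => spow_le hs0.le hx0.le hsx he
  -- sizes
  have hM₃le : M₃ ≤ x / (M₁ * M₂) := by rw [le_div_iff₀ hP0]; linarith [mul_comm (M₁ * M₂) M₃]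
  have hM₁le : M₁ ≤ x ^ (26815 / 100000 : ℝ) := by
    have h2 : M₁ ^ 2 ≤ x ^ (5363 / 10000 : ℝ) := by nlinarith
    calc M₁ = (M₁ ^ 2) ^ ((1 : ℝ) / 2) := by
          rw [← Real.rpow_natCast, ← Real.rpow_mul hM₁0.le]; norm_num
      _ ≤ (x ^ (5363 / 10000 : ℝ)) ^ ((1 : ℝ) / 2) := Real.rpow_le_rpow (sq_nonneg _) h2 (by norm_num)
      _ = x ^ (26815 / 100000 : ℝ) := by rw [← Real.rpow_mul hx0.le]; norm_num
  have hM₂le : M₂ ≤ x ^ (3063 / 10000 : ℝ) := by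
    have h1 : M₁ * M₂ ≤ x ^ (23 / 100 : ℝ) * x ^ (3063 / 10000 : ℝ) := by
      rw [← Real.rpow_add hx0]; norm_num; exact hM12
    by_contra hcon
    push Not at hcon
    have : x ^ (23 / 100 : ℝ) * x ^ (3063 / 10000 : ℝ) < M₁ * M₂ :=
      mul_lt_mul' hM₁lo hcon (by positivity) hM₁0
    linarith
  have hsqM₁ : Real.sqrt M₁ ≤ x ^ (134075 / 1000000 : ℝ) := by
    calc Real.sqrt M₁ ≤ Real.sqrt (x ^ (26815 / 100000 : ℝ)) := Real.sqrt_le_sqrt hM₁le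
      _ = x ^ (134075 / 1000000 : ℝ) := by rw [Real.sqrt_eq_rpow, ← Real.rpow_mul hx0.le]; norm_num
  -- the loss factor
  have hloss : C₃ * (s * V) ^ η * d * Mdiv * L ^ 2 * ℓ ^ 2 ≤ cL0 * x ^ (8 * η) := by
    have hsV : (s * V) ^ η ≤ 4 ^ η * x ^ η := by
      have h1 : s * V ≤ 4 * x := by
        have hV' : V ≤ 4 * M₁ := hV
        have hsx1 : s ≤ x := hsx.trans (Real.rpow_le_self_of_one_le hx (by norm_num))
        have hM₁x : M₁ ≤ x := hM₁le.trans (Real.rpow_le_self_of_one_le hx (by norm_num))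
        -- crude: `s V ≤ x^θ · 4 M₁ ≤ 4 x^{θ + 0.27} ≤ 4x`
        calc s * V ≤ x ^ (87 / 170 : ℝ) * (4 * x ^ (26815 / 100000 : ℝ)) :=
              mul_le_mul hsx (hV.trans (by linarith)) hV0 (by positivity)
          _ = 4 * x ^ ((87 : ℝ) / 170 + 26815 / 100000) := by rw [Real.rpow_add hx0]; ring
          _ ≤ 4 * x ^ (1 : ℝ) := by
              refine mul_le_mul_of_nonneg_left (Real.rpow_le_rpow_of_exponent_le hx (by norm_num)) (by norm_num)
          _ = 4 * x := by rw [Real.rpow_one]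
      calc (s * V) ^ η ≤ (4 * x) ^ η := Real.rpow_le_rpow (by positivity) h1 hη0
        _ = 4 ^ η * x ^ η := Real.mul_rpow (by norm_num) hx0.le
    have hd' : d ≤ Cτ * x ^ η := hd.trans (mul_le_mul_of_nonneg_left ((hsx' η hη0).trans
      (Real.rpow_le_rpow_of_exponent_le hx (by nlinarith))) hCτ0)
    have hL' : L ≤ c₁ * x ^ η := hL.trans (mul_le_mul_of_nonneg_left ((hsx' η hη0).trans
      (Real.rpow_le_rpow_of_exponent_le hx (by nlinarith))) (by linarith))
    have hℓ' : ℓ ≤ 2 * (c₁ * x ^ η) := hℓ.trans (by linarith)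
    calc C₃ * (s * V) ^ η * d * Mdiv * L ^ 2 * ℓ ^ 2
        ≤ C₃ * (4 ^ η * x ^ η) * (Cτ * x ^ η) * (4 * Cτ * x ^ (2 * η)) * (c₁ * x ^ η) ^ 2 * (2 * (c₁ * x ^ η)) ^ 2 := by
          gcongr
      _ = cL0 * (x ^ η * x ^ η * x ^ (2 * η) * (x ^ η) ^ 2 * (x ^ η) ^ 2) := by rw [hcL0]; ring
      _ = cL0 * x ^ (8 * η) := by
          congr 1
          rw [← Real.rpow_natCast (x ^ η) 2, ← Real.rpow_mul hx0.le, ← Real.rpow_add hx0, ← Real.rpow_add hx0,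
            ← Real.rpow_add hx0, ← Real.rpow_add hx0]
          push_cast; ring_nf
  -- the polynomial part times `s⁴`
  have hpoly : I ^ 3 * (R₁ + Kp) * (Jp ^ 2 * (1 + V ^ 2 / s + V * Real.sqrt V / Real.sqrt s)) * s ^ 4 ≤
      360 * (M₁ ^ 2 * M₂ ^ 3 * M₃ * s ^ 4 + 16 * (M₁ ^ 4 * M₂ ^ 3 * M₃ * s ^ 3) +
        8 * (M₁ ^ 3 * Real.sqrt M₁ * M₂ ^ 3 * M₃ * (s ^ 3 * Real.sqrt s))) := by
    have hI3 : I ^ 3 ≤ (2 * M₂) ^ 3 := pow_le_pow_left₀ hI0 hI 3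
    have hRK : R₁ + Kp ≤ 5 * M₃ := by linarith
    have hJ2 : Jp ^ 2 ≤ (3 * M₁) ^ 2 := pow_le_pow_left₀ hJp0 hJp 2
    have hsqV : Real.sqrt V ≤ 2 * Real.sqrt M₁ := by
      calc Real.sqrt V ≤ Real.sqrt (4 * M₁) := Real.sqrt_le_sqrt hV
        _ = 2 * Real.sqrt M₁ := by
            rw [Real.sqrt_mul (by norm_num), show (4 : ℝ) = 2 ^ 2 by norm_num, Real.sqrt_sq (by norm_num)]
    have hss : Real.sqrt s * Real.sqrt s = s := Real.mul_self_sqrt hs0.le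
    have hbr : (1 + V ^ 2 / s + V * Real.sqrt V / Real.sqrt s) * s ^ 4 ≤
        s ^ 4 + 16 * M₁ ^ 2 * s ^ 3 + 8 * (M₁ * Real.sqrt M₁) * (s ^ 3 * Real.sqrt s) := by
      have hsq0 : 0 < Real.sqrt s := Real.sqrt_pos.mpr hs0
      have e : (1 + V ^ 2 / s + V * Real.sqrt V / Real.sqrt s) * s ^ 4 =
          s ^ 4 + V ^ 2 * s ^ 3 + V * Real.sqrt V * (s ^ 3 * Real.sqrt s) := by
        field_simp
        ring_nf
        rw [Real.sq_sqrt hs0.le]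
        ring
      rw [e]
      have h1 : V ^ 2 ≤ 16 * M₁ ^ 2 := by nlinarith
      have h2 : V * Real.sqrt V ≤ 8 * (M₁ * Real.sqrt M₁) := by
        calc V * Real.sqrt V ≤ (4 * M₁) * (2 * Real.sqrt M₁) := mul_le_mul hV hsqV (Real.sqrt_nonneg _) (by positivity)
          _ = 8 * (M₁ * Real.sqrt M₁) := by ring
      have hs3 : 0 ≤ s ^ 3 * Real.sqrt s := by positivity
      nlinarith [mul_le_mul_of_nonneg_right h2 hs3, mul_le_mul_of_nonneg_right h1 (pow_nonneg hs0.le 3)]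
    calc I ^ 3 * (R₁ + Kp) * (Jp ^ 2 * (1 + V ^ 2 / s + V * Real.sqrt V / Real.sqrt s)) * s ^ 4
        = I ^ 3 * (R₁ + Kp) * Jp ^ 2 * ((1 + V ^ 2 / s + V * Real.sqrt V / Real.sqrt s) * s ^ 4) := by ring
      _ ≤ (2 * M₂) ^ 3 * (5 * M₃) * (3 * M₁) ^ 2 * (s ^ 4 + 16 * M₁ ^ 2 * s ^ 3 + 8 * (M₁ * Real.sqrt M₁) * (s ^ 3 * Real.sqrt s)) := by
          gcongr
      _ = _ := by ring
  -- the three monomials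
  have m1 : M₁ ^ 2 * M₂ ^ 3 * M₃ * s ^ 4 ≤ x ^ (399952 / 100000 : ℝ) := by
    calc M₁ ^ 2 * M₂ ^ 3 * M₃ * s ^ 4 ≤ M₁ ^ 2 * M₂ ^ 3 * (x / (M₁ * M₂)) * s ^ 4 := by gcongr
      _ = x * (M₁ * M₂) * M₂ * s ^ 4 := by field_simp
      _ ≤ x * x ^ (5363 / 10000 : ℝ) * x ^ (3063 / 10000 : ℝ) * x ^ ((87 / 170 : ℝ) * 4) := by
          gcongr
          rw [← Real.rpow_natCast]; exact hsx' 4 (by norm_num)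
      _ = x ^ ((1 : ℝ) + 5363 / 10000 + 3063 / 10000 + 87 / 170 * 4) := by
          rw [Real.rpow_add hx0, Real.rpow_add hx0, Real.rpow_add hx0, Real.rpow_one]
      _ ≤ x ^ (399952 / 100000 : ℝ) := hxpow _ (by norm_num)
  have m2 : M₁ ^ 4 * M₂ ^ 3 * M₃ * s ^ 3 ≤ x ^ (399952 / 100000 : ℝ) := by
    calc M₁ ^ 4 * M₂ ^ 3 * M₃ * s ^ 3 ≤ M₁ ^ 4 * M₂ ^ 3 * (x / (M₁ * M₂)) * s ^ 3 := by gcongr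
      _ = x * (M₁ * M₂) ^ 2 * M₁ * s ^ 3 := by field_simp
      _ ≤ x * (x ^ (5363 / 10000 : ℝ)) ^ 2 * x ^ (26815 / 100000 : ℝ) * x ^ ((87 / 170 : ℝ) * 3) := by
          gcongr
          rw [← Real.rpow_natCast]; exact hsx' 3 (by norm_num)
      _ = x ^ ((1 : ℝ) + 2 * (5363 / 10000) + 26815 / 100000 + 87 / 170 * 3) := by
          rw [← Real.rpow_natCast (x ^ (5363 / 10000 : ℝ)) 2, ← Real.rpow_mul hx0.le, Real.rpow_add hx0,
            Real.rpow_add hx0, Real.rpow_add hx0, Real.rpow_one]; push_cast; ring_nf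
      _ ≤ x ^ (399952 / 100000 : ℝ) := hxpow _ (by norm_num)
  have m3 : M₁ ^ 3 * Real.sqrt M₁ * M₂ ^ 3 * M₃ * (s ^ 3 * Real.sqrt s) ≤ x ^ (399952 / 100000 : ℝ) := by
    have hs35 : s ^ 3 * Real.sqrt s = s ^ (7 / 2 : ℝ) := by
      rw [Real.sqrt_eq_rpow, ← Real.rpow_natCast s 3, ← Real.rpow_add hs0]; norm_num
    rw [hs35]
    calc M₁ ^ 3 * Real.sqrt M₁ * M₂ ^ 3 * M₃ * s ^ (7 / 2 : ℝ)
        ≤ M₁ ^ 3 * Real.sqrt M₁ * M₂ ^ 3 * (x / (M₁ * M₂)) * s ^ (7 / 2 : ℝ) := by gcongr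
      _ = x * (M₁ * M₂) ^ 2 * Real.sqrt M₁ * s ^ (7 / 2 : ℝ) := by field_simp
      _ ≤ x * (x ^ (5363 / 10000 : ℝ)) ^ 2 * x ^ (134075 / 1000000 : ℝ) * x ^ ((87 / 170 : ℝ) * (7 / 2)) := by
          gcongr
          exact hsx' _ (by norm_num)
      _ = x ^ ((1 : ℝ) + 2 * (5363 / 10000) + 134075 / 1000000 + 87 / 170 * (7 / 2)) := by
          rw [← Real.rpow_natCast (x ^ (5363 / 10000 : ℝ)) 2, ← Real.rpow_mul hx0.le, Real.rpow_add hx0,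
            Real.rpow_add hx0, Real.rpow_add hx0, Real.rpow_one]; push_cast; ring_nf
      _ ≤ x ^ (399952 / 100000 : ℝ) := hxpow _ (by norm_num)
  -- assemble: `T s⁴ ≤ (K4 x^{1-δ})⁴`
  set T := C₃ * (s * V) ^ η * d * Mdiv * L ^ 2 * ℓ ^ 2 * I ^ 3 * (R₁ + Kp) *
    (Jp ^ 2 * (1 + V ^ 2 / s + V * Real.sqrt V / Real.sqrt s)) with hT
  have hT0 : 0 ≤ T := by positivity
  have hmain : T * s ^ 4 ≤ (K4 * x ^ (1 - 1 / 10000 : ℝ)) ^ 4 := by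
    have e : T * s ^ 4 = (C₃ * (s * V) ^ η * d * Mdiv * L ^ 2 * ℓ ^ 2) *
        (I ^ 3 * (R₁ + Kp) * (Jp ^ 2 * (1 + V ^ 2 / s + V * Real.sqrt V / Real.sqrt s)) * s ^ 4) := by
      rw [hT]; ring
    rw [e]
    have h1 := mul_le_mul hloss hpoly (by positivity) (by positivity)
    refine h1.trans ?_
    have hX4 : 0 ≤ x ^ (399952 / 100000 : ℝ) := by positivity
    have h2 : 360 * (M₁ ^ 2 * M₂ ^ 3 * M₃ * s ^ 4 + 16 * (M₁ ^ 4 * M₂ ^ 3 * M₃ * s ^ 3) +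
        8 * (M₁ ^ 3 * Real.sqrt M₁ * M₂ ^ 3 * M₃ * (s ^ 3 * Real.sqrt s))) ≤ 360 * 25 * x ^ (399952 / 100000 : ℝ) := by
      linarith [m1, m2, m3]
    have hK4pow : cL0 * 360 * 25 ≤ K4 ^ 4 := by
      have h3 : cL0 * 360 * 25 ≤ K4 := by rw [hK4]; linarith
      calc cL0 * 360 * 25 ≤ K4 := h3
        _ = K4 * 1 * 1 * 1 := by ring
        _ ≤ K4 * K4 * K4 * K4 := by gcongr
        _ = K4 ^ 4 := by ring
    have hxe : x ^ (8 * η) * x ^ (399952 / 100000 : ℝ) ≤ x ^ (4 * (1 - 1 / 10000 : ℝ)) := by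
      rw [← Real.rpow_add hx0]
      exact Real.rpow_le_rpow_of_exponent_le hx (by linarith)
    have hx4 : (x ^ (1 - 1 / 10000 : ℝ)) ^ 4 = x ^ (4 * (1 - 1 / 10000 : ℝ)) := by
      rw [← Real.rpow_natCast, ← Real.rpow_mul hx0.le]; ring_nf
    calc cL0 * x ^ (8 * η) * (360 * (M₁ ^ 2 * M₂ ^ 3 * M₃ * s ^ 4 + 16 * (M₁ ^ 4 * M₂ ^ 3 * M₃ * s ^ 3) +
          8 * (M₁ ^ 3 * Real.sqrt M₁ * M₂ ^ 3 * M₃ * (s ^ 3 * Real.sqrt s))))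
        ≤ cL0 * x ^ (8 * η) * (360 * 25 * x ^ (399952 / 100000 : ℝ)) := by
          refine mul_le_mul_of_nonneg_left h2 (by positivity)
      _ = (cL0 * 360 * 25) * (x ^ (8 * η) * x ^ (399952 / 100000 : ℝ)) := by ring
      _ ≤ K4 ^ 4 * x ^ (4 * (1 - 1 / 10000 : ℝ)) := mul_le_mul hK4pow hxe (by positivity) (by positivity)
      _ = (K4 * x ^ (1 - 1 / 10000 : ℝ)) ^ 4 := by rw [mul_pow, hx4]
  exact rpow_quarter_mul_le hT0 hs0.le (by positivity) hmain

end Numerology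

/-! ### Small helpers for the assembly -/

omit [NeZero q] in
/-- `64^{ω(n)} ≤ d(n)^6`. [folklore] -/
theorem pow64_omega_le {n : ℕ} (hn : n ≠ 0) : (64 : ℝ) ^ n.primeFactors.card ≤ ((Nat.divisors n).card : ℝ) ^ 6 := by
  have h := two_pow_card_primeFactors_le_card_divisors hn
  have h' : ((2 : ℝ) ^ n.primeFactors.card) ≤ (Nat.divisors n).card := by exact_mod_cast h
  calc (64 : ℝ) ^ n.primeFactors.card = ((2 : ℝ) ^ n.primeFactors.card) ^ 6 := by
        rw [← pow_mul, mul_comm, pow_mul]; norm_num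
    _ ≤ ((Nat.divisors n).card : ℝ) ^ 6 := pow_le_pow_left₀ (by positivity) h' 6

omit [NeZero q] in
/-- `log₂ n + 1 ≤ 2 (1 + log n)` (`n ≥ 1`). [folklore] -/
theorem natLog_two_add_one_le {n : ℕ} (hn : 1 ≤ n) : ((Nat.log 2 n + 1 : ℕ) : ℝ) ≤ 2 * (1 + Real.log n) := by
  have hn0 : (0 : ℝ) < n := by exact_mod_cast hn
  have h2 : (2 : ℝ) ^ (Nat.log 2 n) ≤ n := by exact_mod_cast Nat.pow_log_le_self 2 (by omega)
  have hlog := Real.log_le_log (by positivity) h2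
  rw [Real.log_pow] at hlog
  have hl2 : (1 : ℝ) / 2 < Real.log 2 := by
    have := Real.log_two_gt_d9; linarith
  have hk0 : (0 : ℝ) ≤ Nat.log 2 n := Nat.cast_nonneg _
  have : (Nat.log 2 n : ℝ) * (1 / 2) ≤ Real.log n := by nlinarith
  push_cast
  have hlogn : 0 ≤ Real.log n := Real.log_nonneg (by exact_mod_cast hn)
  linarith

omit [NeZero q] in
/-- `⌊2y⌋₊ ≤ 2⌊y⌋₊ + 1` (`y ≥ 0`). [folklore] -/
theorem floor_two_mul_le {y : ℝ} (hy : 0 ≤ y) : ⌊2 * y⌋₊ ≤ 2 * ⌊y⌋₊ + 1 := by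
  have h1 : y < ⌊y⌋₊ + 1 := Nat.lt_floor_add_one y
  have h2 : ⌊2 * y⌋₊ < 2 * ⌊y⌋₊ + 2 := (Nat.floor_lt (by positivity)).mpr (by push_cast; linarith)
  omega

/-! ### The assembly -/

set_option maxHeartbeats 1600000 in
/-- **Fouvry–Tenenbaum's Lemma 4.13 at `θ = 1/2 + 1/85`, conditionally on (i) a Lemma-4-type bound
for Heath-Brown's `S(k, t; ρ, σ; s)` at all moduli (which Heath-Brown derives from Weil — Lemmas 2, 3 —
and the Birch–Bombieri bound — Lemma 1; see `norm_SS_le_dA_L4B` and the Lemma-1 file), and (ii)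
Deligne's prime bound for `K₂`.**  Proof = Heath-Brown §7: the three estimates (Lemma 5 =
`abs_boxSum_gAP_le_principal`, Lemma 6-type = `abs_sum_apBox3_gAP_le`, Lemma 7 = `sum3_gAP_le`)
according to the shape of the boxes (`M₁ ≤ x^{0.23}`; `M₃ ≤ x^{0.4637}`; otherwise), with
`δ = 10⁻⁴`. [cite: HeathBrown1986d3, §7; FouvryTenenbaum2021, Lemma 4.13] -/
theorem lemma413_of_L4all_deligne {CL cL : ℝ} (hCL : 0 ≤ CL) (hcL : 0 ≤ cL)
    (hL4all : ∀ (s : ℕ) [NeZero s] (k t₁ t₂ ρ σ : ℤ),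
      ‖SS s (k : ZMod s) (t₁ : ZMod s) (t₂ : ZMod s) (ρ : ZMod s) (σ : ZMod s)‖ ≤
        CL * ((Nat.divisors s).card : ℝ) ^ cL * (s : ℝ) ^ (5 / 2 : ℝ) * L4shape s k t₁ t₂ ρ σ)
    (hDel : ∀ (p : ℕ) [Fact p.Prime] (a₁ a₂ a₃ : ZMod p), a₁ ≠ 0 → a₂ ≠ 0 → a₃ ≠ 0 → ‖K2 p a₁ a₂ a₃‖ ≤ 3 * p) :
    FouvryTenenbaum2021_lemma413 := by
  -- constants
  set η : ℝ := 1 / 100000 / (1 + cL) with hη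
  have hη0 : 0 < η := by rw [hη]; positivity
  have hcL1 : (0 : ℝ) < 1 + cL := by linarith
  have hη1 : η ≤ 1 / 100000 := by
    rw [hη, div_le_iff₀ hcL1]; nlinarith
  have hηcL : η * cL ≤ 1 / 100000 := by
    rw [hη, div_mul_eq_mul_div, div_le_iff₀ hcL1]; nlinarith
  obtain ⟨Cτ, hCτ1, hCτ⟩ := exists_card_divisors_le_mul_rpow hη0
  have hCτ0 : 0 ≤ Cτ := zero_le_one.trans hCτ1
  set c₁ : ℝ := 1 + 1 / η with hc₁
  have hc₁1 : 1 ≤ c₁ := by rw [hc₁]; have : 0 < 1 / η := div_pos one_pos hη0; linarith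
  obtain ⟨C₃, hC₃0, hC₃⟩ := sum3_gAP_le hη0
  obtain ⟨CB, hCB0, hCB⟩ := num_caseB hCτ1 hc₁1 hCL hcL hη0.le hη1 hηcL
  obtain ⟨CC, hCC0, hCC⟩ := num_caseC hCτ1 hc₁1 hC₃0.le hη0.le hη1
  refine ⟨1 / 10000, 0, 12 * Cτ ^ 2 * c₁ ^ 2 + CB + (2 * CC + 8 * Cτ * c₁), by norm_num, ?_⟩
  intro x hx M₁ M₂ M₃ lo₁ hi₁ lo₂ hi₂ lo₃ hi₃ hM₁ h12 h23 hprod hlo₁ hhi₁ hlo₂ hhi₂ hlo₃ hhi₃ s D a t₁ t₂ t₃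
    hs hsx hD hsa _
  -- basic facts
  have hs0 : 0 < s := hs
  haveI : NeZero s := ⟨hs0.ne'⟩
  have hsR : (0 : ℝ) < s := by exact_mod_cast hs0
  have hs1 : (1 : ℝ) ≤ s := by exact_mod_cast hs0
  have hD0 : 0 < D := hD
  have hφ : (0 : ℝ) < Nat.totient s := by exact_mod_cast Nat.totient_pos.2 hs0
  have hφs : (Nat.totient s : ℝ) ≤ s := by exact_mod_cast Nat.totient_le s
  have hDs : D.Coprime s := coprime_of_isCoprime_mul hsa
  have ha : IsUnit ((a : ℤ) : ZMod s) := (ZMod.coe_int_isUnit_iff_isCoprime a s).2 hsa.of_mul_right_left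
  have ha' : IsCoprime (s : ℤ) a := hsa.of_mul_right_left
  have hx0 : 0 < x := by linarith
  have hx1 : (1 : ℝ) ≤ x ^ (1 / 100 : ℝ) := Real.one_le_rpow hx (by norm_num)
  have hM₁1 : 1 ≤ M₁ := hx1.trans hM₁
  have hM₁0 : 0 ≤ M₁ := zero_le_one.trans hM₁1
  have hM₂1 : 1 ≤ M₂ := hM₁1.trans h12
  have hM₂0 : 0 ≤ M₂ := zero_le_one.trans hM₂1
  have hM₃1 : 1 ≤ M₃ := hM₂1.trans h23
  have hM₃0 : 0 ≤ M₃ := zero_le_one.trans hM₃1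
  have hθ : (1 / 2 + 1 / 85 : ℝ) = 87 / 170 := by norm_num
  rw [hθ] at hsx
  rw [Real.rpow_zero, mul_one]
  -- names
  set b₁ := (Ioc ⌊lo₁⌋₊ ⌊hi₁⌋₊).filter (fun m : ℕ => (m : ZMod D) = (t₁ : ZMod D)) with hb₁
  set b₂ := (Ioc ⌊lo₂⌋₊ ⌊hi₂⌋₊).filter (fun m : ℕ => (m : ZMod D) = (t₂ : ZMod D)) with hb₂
  set b₃ := (Ioc ⌊lo₃⌋₊ ⌊hi₃⌋₊).filter (fun m : ℕ => (m : ZMod D) = (t₃ : ZMod D)) with hb₃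
  set d : ℝ := ((Nat.divisors s).card : ℝ) with hd
  set L : ℝ := 1 + Real.log s with hL
  have hL0 : 0 ≤ L := by have := Real.log_nonneg hs1; rw [hL]; linarith
  have hd1 : 1 ≤ d := by
    rw [hd]; exact_mod_cast Finset.card_pos.mpr ⟨1, Nat.one_mem_divisors.mpr hs0.ne'⟩
  have hd0 : 0 ≤ d := zero_le_one.trans hd1
  have hdle : d ≤ Cτ * (s : ℝ) ^ η := hCτ s hs0.ne'
  have hLle : L ≤ c₁ * (s : ℝ) ^ η := by
    have h1 : Real.log s ≤ (s : ℝ) ^ η / η := Real.log_le_rpow_div hsR.le hη0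
    have h2 : (1 : ℝ) ≤ (s : ℝ) ^ η := Real.one_le_rpow hs1 hη0.le
    have h3 : c₁ * (s : ℝ) ^ η = (s : ℝ) ^ η + (s : ℝ) ^ η / η := by rw [hc₁]; ring
    rw [h3, hL]; linarith
  have hb₁le : (b₁.card : ℝ) ≤ 2 * M₁ := card_apBox_le_two_mul hM₁1 hlo₁ hhi₁ D t₁
  have hb₂le : (b₂.card : ℝ) ≤ 2 * M₂ := card_apBox_le_two_mul hM₂1 hlo₂ hhi₂ D t₂
  have hb₃le : (b₃.card : ℝ) ≤ 2 * M₃ := card_apBox_le_two_mul hM₃1 hlo₃ hhi₃ D t₃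
  have hM12 : M₁ * M₂ ≤ x ^ (2 / 3 : ℝ) := mul_le_rpow_two_thirds hM₁0 hM₂0 (h12.trans h23) h23 hx0.le hprod
  have hxpow : ∀ e : ℝ, e ≤ 1 - 1 / 10000 → x ^ e ≤ x ^ (1 - 1 / 10000 : ℝ) := fun e he =>
    Real.rpow_le_rpow_of_exponent_le hx he
  have hX0 : 0 ≤ x ^ (1 - 1 / 10000 : ℝ) := by positivity
  -- clear `φ(s)`
  rw [le_div_iff₀ hφ]
  have habs0 : 0 ≤ |∑ m₁ ∈ b₁, ∑ m₂ ∈ b₂, ∑ m₃ ∈ b₃, gAP s a (m₁ * m₂ * m₃)| := abs_nonneg _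
  -- dL ≤ Cτ c₁ s^{2η} ≤ Cτ c₁ x^{2η θ}
  have hdL : d * L ≤ Cτ * c₁ * x ^ ((87 / 170 : ℝ) * (2 * η)) := by
    calc d * L ≤ (Cτ * (s : ℝ) ^ η) * (c₁ * (s : ℝ) ^ η) := mul_le_mul hdle hLle hL0 (by positivity)
      _ = Cτ * c₁ * ((s : ℝ) ^ η * (s : ℝ) ^ η) := by ring
      _ = Cτ * c₁ * (s : ℝ) ^ (2 * η) := by rw [← Real.rpow_add hsR]; ring_nf
      _ ≤ Cτ * c₁ * x ^ ((87 / 170 : ℝ) * (2 * η)) :=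
          mul_le_mul_of_nonneg_left (spow_le hsR.le hx0.le hsx (by positivity)) (by positivity)
  rcases le_or_gt M₁ (x ^ (23 / 100 : ℝ)) with hA | hA
  · -- Case A: `E₂`
    rcases le_or_gt ⌊lo₂⌋₊ ⌊hi₂⌋₊ with hLR | hLR
    swap
    · have hb₂e : b₂ = ∅ := by
        rw [hb₂, Finset.filter_eq_empty_iff]
        intro m hm
        have := Finset.mem_Ioc.mp hm; omega
      simp only [hb₂e, Finset.sum_empty, Finset.sum_const_zero, abs_zero, zero_mul]
      positivity
    have hE := abs_sum_apBox3_gAP_le hD0 hDs ha' ⌊lo₁⌋₊ ⌊hi₁⌋₊ hLR ⌊lo₃⌋₊ ⌊hi₃⌋₊ t₁ t₂ t₃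
    set len₂ : ℝ := (⌊hi₂⌋₊ : ℝ) - ⌊lo₂⌋₊ with hlen
    have hLR' : (⌊lo₂⌋₊ : ℝ) ≤ ⌊hi₂⌋₊ := by exact_mod_cast hLR
    have hlen0 : 0 ≤ len₂ := by rw [hlen]; linarith
    have hlen2 : len₂ ≤ 2 * M₂ := by
      rcases le_or_gt 0 hi₂ with hh | hh
      · have h1 : (⌊hi₂⌋₊ : ℝ) ≤ hi₂ := Nat.floor_le hh
        have h2 : (0 : ℝ) ≤ ⌊lo₂⌋₊ := Nat.cast_nonneg _
        rw [hlen]; linarith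
      · have : ⌊hi₂⌋₊ = 0 := Nat.floor_eq_zero.mpr (by linarith)
        rw [hlen, this]; push_cast; linarith [Nat.cast_nonneg (α := ℝ) ⌊lo₂⌋₊]
    have hφs1 : (Nat.totient s : ℝ) / s ≤ 1 := (div_le_one hsR).mpr hφs
    have hs32 : Real.sqrt s * s = (s : ℝ) ^ (3 / 2 : ℝ) := by
      rw [Real.sqrt_eq_rpow, ← Real.rpow_add_one' hsR.le (by norm_num)]; norm_num
    have hnum := num_caseA hx hs1 hsx hη0.le hη1 hA hM12 hCτ1 hc₁1 hd0 hdle hL0 hLle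
    calc |∑ m₁ ∈ b₁, ∑ m₂ ∈ b₂, ∑ m₃ ∈ b₃, gAP s a (m₁ * m₂ * m₃)| * (Nat.totient s : ℝ)
        ≤ ((b₁.card : ℝ) * (d * L * ((len₂ + 1) / s + d * Real.sqrt s * L + len₂ / Nat.totient s))) *
            (Nat.totient s : ℝ) := mul_le_mul_of_nonneg_right hE hφ.le
      _ = (b₁.card : ℝ) * (d * L) * ((len₂ + 1) * ((Nat.totient s : ℝ) / s) +
            d * L * (Real.sqrt s * (Nat.totient s : ℝ)) + len₂) := by
          field_simp
      _ ≤ (2 * M₁) * (d * L) * ((2 * M₂ + 1) * 1 + d * L * (Real.sqrt s * s) + 2 * M₂) := by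
          gcongr
      _ ≤ (2 * M₁) * (d * L) * (5 * M₂ + d * L * (s : ℝ) ^ (3 / 2 : ℝ)) := by
          rw [hs32]
          refine mul_le_mul_of_nonneg_left ?_ (by positivity)
          linarith
      _ = 10 * (M₁ * M₂) * (d * L) + 2 * M₁ * (d ^ 2 * L ^ 2) * (s : ℝ) ^ (3 / 2 : ℝ) := by ring
      _ ≤ 12 * Cτ ^ 2 * c₁ ^ 2 * x ^ (1 - 1 / 10000 : ℝ) := hnum
      _ ≤ (12 * Cτ ^ 2 * c₁ ^ 2 + CB + (2 * CC + 8 * Cτ * c₁)) * x ^ (1 - 1 / 10000 : ℝ) := by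
          refine mul_le_mul_of_nonneg_right ?_ hX0
          have : 0 ≤ 2 * CC + 8 * Cτ * c₁ := by positivity
          linarith
  rcases le_or_gt M₃ (x ^ (4637 / 10000 : ℝ)) with hB | hB
  · -- Case B: `E₁`
    set A₄ : ℝ := CL * d ^ cL * (s : ℝ) ^ (5 / 2 : ℝ) with hA₄
    have hA₄0 : 0 ≤ A₄ := mul_nonneg (mul_nonneg hCL (Real.rpow_nonneg hd0 _)) (by positivity)
    have hL4s : ∀ k u₁ u₂ ρ σ : ℤ, ‖SS s (k : ZMod s) (u₁ : ZMod s) (u₂ : ZMod s) (ρ : ZMod s) (σ : ZMod s)‖ ≤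
        A₄ * L4shape s k u₁ u₂ ρ σ := fun k u₁ u₂ ρ σ => hL4all s k u₁ u₂ ρ σ
    set maxd : ℝ := Cτ * ((s : ℝ) ^ 2) ^ η with hmaxd_def
    have hmaxd0 : 0 ≤ maxd := by positivity
    have hmaxdH : ∀ h : ℕ, h ≤ s ^ 2 → ((Nat.divisors h).card : ℝ) ≤ maxd := by
      intro h hh
      rcases Nat.eq_zero_or_pos h with h0 | h0
      · subst h0; simp only [Nat.divisors_zero, Finset.card_empty, Nat.cast_zero]; exact hmaxd0
      · calc ((Nat.divisors h).card : ℝ) ≤ Cτ * (h : ℝ) ^ η := hCτ h h0.ne'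
          _ ≤ Cτ * ((s : ℝ) ^ 2) ^ η := by
              refine mul_le_mul_of_nonneg_left (Real.rpow_le_rpow (Nat.cast_nonneg _) ?_ hη0.le) hCτ0
              exact_mod_cast hh
    have hE := abs_boxSum_gAP_le_principal hD0 hDs ha hA₄0 hL4s hDel ⌊lo₁⌋₊ ⌊hi₁⌋₊ ⌊lo₂⌋₊ ⌊hi₂⌋₊ ⌊lo₃⌋₊ ⌊hi₃⌋₊
      t₁ t₂ t₃ hb₁le hb₂le hb₃le hmaxdH
    have hd3 : (d3 s : ℝ) ≤ d ^ 2 := by rw [hd]; exact_mod_cast d3_le s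
    have hnum := hCB x s M₁ M₂ M₃ d L ((Nat.log 2 s + 1 : ℕ) : ℝ) ((64 : ℝ) ^ s.primeFactors.card) (d3 s : ℝ)
      hx hs1 hsx hM₁0 hM₂0 hM12 hM₃0 hB hd1 hdle hL0 hLle (Nat.cast_nonneg _) (natLog_two_add_one_le hs0)
      (by positivity) (pow64_omega_le hs0.ne') (Nat.cast_nonneg _) hd3
    have key : |∑ m₁ ∈ b₁, ∑ m₂ ∈ b₂, ∑ m₃ ∈ b₃, gAP s a (m₁ * m₂ * m₃)| * (Nat.totient s : ℝ) ≤
        (s : ℝ) * (2 * (((s : ℝ)⁻¹) ^ 3 * (4 * ((Nat.log 2 s + 1 : ℕ) : ℝ) ^ 3 * 64 ^ s.primeFactors.card *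
          Wconst s (2 * M₁) (2 * M₂) (2 * M₃) A₄ (d * L) (((s : ℝ) * d3 s) ^ 2) maxd))) := by
      calc |∑ m₁ ∈ b₁, ∑ m₂ ∈ b₂, ∑ m₃ ∈ b₃, gAP s a (m₁ * m₂ * m₃)| * (Nat.totient s : ℝ)
          ≤ |∑ m₁ ∈ b₁, ∑ m₂ ∈ b₂, ∑ m₃ ∈ b₃, gAP s a (m₁ * m₂ * m₃)| * (s : ℝ) :=
            mul_le_mul_of_nonneg_left hφs habs0
        _ ≤ (2 * (((s : ℝ)⁻¹) ^ 3 * (4 * ((Nat.log 2 s + 1 : ℕ) : ℝ) ^ 3 * 64 ^ s.primeFactors.card *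
              Wconst s (2 * M₁) (2 * M₂) (2 * M₃) A₄ (d * L) (((s : ℝ) * d3 s) ^ 2) maxd))) * (s : ℝ) :=
            mul_le_mul_of_nonneg_right hE hsR.le
        _ = _ := by ring
    have h2 : |∑ m₁ ∈ b₁, ∑ m₂ ∈ b₂, ∑ m₃ ∈ b₃, gAP s a (m₁ * m₂ * m₃)| * (Nat.totient s : ℝ) ≤
        CB * x ^ (1 - 1 / 10000 : ℝ) := by
      refine key.trans ?_
      unfold Wconst
      exact hnum
    refine h2.trans (mul_le_mul_of_nonneg_right ?_ hX0)
    have : 0 ≤ 2 * CC + 8 * Cτ * c₁ := by positivity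
    have : 0 ≤ 12 * Cτ ^ 2 * c₁ ^ 2 := by positivity
    linarith
  · -- Case C: `E₃`
    -- sizes
    have hxB : 0 < x ^ (4637 / 10000 : ℝ) := by positivity
    have hM12C : M₁ * M₂ ≤ x ^ (5363 / 10000 : ℝ) := by
      have h1 : M₁ * M₂ * x ^ (4637 / 10000 : ℝ) ≤ M₁ * M₂ * M₃ :=
        mul_le_mul_of_nonneg_left hB.le (mul_nonneg hM₁0 hM₂0)
      have h2 : M₁ * M₂ * x ^ (4637 / 10000 : ℝ) ≤ x ^ (5363 / 10000 : ℝ) * x ^ (4637 / 10000 : ℝ) := by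
        rw [← Real.rpow_add hx0]; norm_num; linarith
      exact le_of_mul_le_mul_right h2 hxB
    have hM₂x : M₂ ≤ x := by
      have h1 : M₂ ≤ M₁ * M₂ := by nlinarith
      exact h1.trans (hM12.trans (Real.rpow_le_self_of_one_le hx (by norm_num)))
    have hsx1 : (s : ℝ) ≤ x := hsx.trans (Real.rpow_le_self_of_one_le hx (by norm_num))
    -- reorder the sum: `u = m₂`, `v = m₁`
    have hre : ∑ m₁ ∈ b₁, ∑ m₂ ∈ b₂, ∑ m₃ ∈ b₃, gAP s a (m₁ * m₂ * m₃) =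
        ∑ m₂ ∈ b₂, ∑ m₁ ∈ b₁, ∑ m₃ ∈ b₃, gAP s a (m₂ * m₁ * m₃) := by
      rw [Finset.sum_comm]
      refine Finset.sum_congr rfl fun m₂ _ => Finset.sum_congr rfl fun m₁ _ => Finset.sum_congr rfl fun m₃ _ => ?_
      rw [mul_comm m₁ m₂]
    rw [hre]
    -- the divisor-bound parameter for `E₃`
    set Mdiv : ℝ := Cτ * ((2 * s * ⌊hi₂⌋₊ : ℕ) : ℝ) ^ η with hMdiv
    have hMdiv0 : 0 ≤ Mdiv := by positivity
    have hMdivH : ∀ n : ℕ, n ≠ 0 → n ≤ 2 * s * ⌊hi₂⌋₊ → ((n.divisors.card : ℕ) : ℝ) ≤ Mdiv := by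
      intro n hn hnle
      calc ((n.divisors.card : ℕ) : ℝ) ≤ Cτ * (n : ℝ) ^ η := hCτ n hn
        _ ≤ Cτ * ((2 * s * ⌊hi₂⌋₊ : ℕ) : ℝ) ^ η := by
            refine mul_le_mul_of_nonneg_left (Real.rpow_le_rpow (Nat.cast_nonneg _) ?_ hη0.le) hCτ0
            exact_mod_cast hnle
    have hR₁ : ((⌊hi₂⌋₊ : ℕ) : ℝ) ≤ 2 * M₂ := by
      rcases le_or_gt 0 hi₂ with hh | hh
      · exact (Nat.floor_le hh).trans hhi₂
      · rw [Nat.floor_eq_zero.mpr (by linarith)]; push_cast; linarith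
    have hMdivle : Mdiv ≤ 4 * Cτ * x ^ (2 * η) := by
      have h1 : ((2 * s * ⌊hi₂⌋₊ : ℕ) : ℝ) ≤ 4 * x ^ 2 := by
        push_cast
        have : (s : ℝ) * (⌊hi₂⌋₊ : ℝ) ≤ x * (2 * x) :=
          mul_le_mul hsx1 (hR₁.trans (by linarith)) (Nat.cast_nonneg _) hx0.le
        nlinarith
      have h2 : ((2 * s * ⌊hi₂⌋₊ : ℕ) : ℝ) ^ η ≤ 4 * x ^ (2 * η) := by
        calc ((2 * s * ⌊hi₂⌋₊ : ℕ) : ℝ) ^ η ≤ (4 * x ^ 2) ^ η := Real.rpow_le_rpow (Nat.cast_nonneg _) h1 hη0.le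
          _ = 4 ^ η * x ^ (2 * η) := by
              rw [Real.mul_rpow (by norm_num) (by positivity), ← Real.rpow_natCast x 2, ← Real.rpow_mul hx0.le]
              norm_num
          _ ≤ 4 ^ (1 : ℝ) * x ^ (2 * η) := by
              refine mul_le_mul_of_nonneg_right ?_ (by positivity)
              exact Real.rpow_le_rpow_of_exponent_le (by norm_num) (by linarith)
          _ = 4 * x ^ (2 * η) := by rw [Real.rpow_one]
      calc Mdiv = Cτ * ((2 * s * ⌊hi₂⌋₊ : ℕ) : ℝ) ^ η := rfl
        _ ≤ Cτ * (4 * x ^ (2 * η)) := mul_le_mul_of_nonneg_left h2 hCτ0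
        _ = 4 * Cτ * x ^ (2 * η) := by ring
    have hKp : (((⌊hi₃⌋₊ - ⌊lo₃⌋₊ : ℕ) : ℝ) / D + 1) ≤ 3 * M₃ := by
      have h1 : ((⌊hi₃⌋₊ - ⌊lo₃⌋₊ : ℕ) : ℝ) ≤ 2 * M₃ := by
        have h2 : ((⌊hi₃⌋₊ - ⌊lo₃⌋₊ : ℕ) : ℝ) ≤ ⌊hi₃⌋₊ := by exact_mod_cast Nat.sub_le _ _
        refine h2.trans ?_
        rcases le_or_gt 0 hi₃ with hh | hh
        · exact (Nat.floor_le hh).trans hhi₃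
        · rw [Nat.floor_eq_zero.mpr (by linarith)]; push_cast; linarith
      have hD1 : (1 : ℝ) ≤ D := by exact_mod_cast hD0
      have h3 : ((⌊hi₃⌋₊ - ⌊lo₃⌋₊ : ℕ) : ℝ) / D ≤ 2 * M₃ := by
        rw [div_le_iff₀ (by positivity)]; nlinarith
      linarith
    have hℓ : ((Nat.log 2 s : ℝ) + 1) ≤ 2 * L := by
      have := natLog_two_add_one_le hs0; push_cast at this; rw [hL]; exact this
    -- the generic piece
    have piece : ∀ (A' B' : ℕ) (V' : ℝ), 1 ≤ V' → V' ≤ (A' : ℝ) → (B' : ℝ) ≤ 2 * V' → V' ≤ 4 * M₁ →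
        (((B' - A' : ℕ) : ℝ) + 1) ≤ 3 * M₁ →
        ((((Ioc A' B').filter (fun m : ℕ => (m : ZMod D) = (t₁ : ZMod D))).card : ℕ) : ℝ) ≤ 2 * M₁ →
        |∑ u ∈ b₂, ∑ v ∈ (Ioc A' B').filter (fun m : ℕ => (m : ZMod D) = (t₁ : ZMod D)), ∑ w ∈ b₃,
            gAP s a (u * v * w)| * (Nat.totient s : ℝ) ≤ (CC + 4 * Cτ * c₁) * x ^ (1 - 1 / 10000 : ℝ) := by
      intro A' B' V' hV1 hVA hBV hV4 hJp hIv
      have hV0 : 0 ≤ V' := zero_le_one.trans hV1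
      have hE := hC₃ s D a t₂ t₁ t₃ ⌊lo₂⌋₊ ⌊hi₂⌋₊ A' B' ⌊lo₃⌋₊ ⌊hi₃⌋₊ V' Mdiv hD0 hDs ha hV1 hVA hBV hMdiv0 hMdivH
      have hnum := hCC x s M₁ M₂ M₃ d L ((Nat.log 2 s : ℝ) + 1) Mdiv V' (((B' - A' : ℕ) : ℝ) + 1) (b₂.card : ℝ)
        ((⌊hi₂⌋₊ : ℕ) : ℝ) (((⌊hi₃⌋₊ - ⌊lo₃⌋₊ : ℕ) : ℝ) / D + 1) hx hs1 hsx hM₁1 hA.le h12 h23 hM12C hprod hd1 hdle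
        hL0 hLle (by positivity) hℓ hMdiv0 hMdivle hV0 hV4 (by positivity) hJp (Nat.cast_nonneg _) hb₂le
        (Nat.cast_nonneg _) hR₁ (by positivity) hKp
      -- second term
      have hsec : (b₂.card : ℝ) * ((((Ioc A' B').filter (fun m : ℕ => (m : ZMod D) = (t₁ : ZMod D))).card : ℕ) : ℝ) *
          d * L ≤ 4 * Cτ * c₁ * x ^ (1 - 1 / 10000 : ℝ) := by
        calc (b₂.card : ℝ) * ((((Ioc A' B').filter (fun m : ℕ => (m : ZMod D) = (t₁ : ZMod D))).card : ℕ) : ℝ) * d * L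
            = ((b₂.card : ℝ) * ((((Ioc A' B').filter (fun m : ℕ => (m : ZMod D) = (t₁ : ZMod D))).card : ℕ) : ℝ)) * (d * L) := by ring
          _ ≤ ((2 * M₂) * (2 * M₁)) * (Cτ * c₁ * x ^ ((87 / 170 : ℝ) * (2 * η))) :=
              mul_le_mul (mul_le_mul hb₂le hIv (Nat.cast_nonneg _) (by positivity)) hdL (by positivity) (by positivity)
          _ = 4 * Cτ * c₁ * ((M₁ * M₂) * x ^ ((87 / 170 : ℝ) * (2 * η))) := by ring
          _ ≤ 4 * Cτ * c₁ * (x ^ (2 / 3 : ℝ) * x ^ ((87 / 170 : ℝ) * (2 * η))) := by gcongr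
          _ = 4 * Cτ * c₁ * x ^ (2 / 3 + (87 / 170 : ℝ) * (2 * η)) := by rw [← Real.rpow_add hx0]
          _ ≤ 4 * Cτ * c₁ * x ^ (1 - 1 / 10000 : ℝ) := by
              refine mul_le_mul_of_nonneg_left (hxpow _ ?_) (by positivity); linarith
      have hsplit := mul_le_mul_of_nonneg_right hE hφ.le
      refine hsplit.trans ?_
      rw [add_mul, div_mul_cancel₀ _ hφ.ne',
        show (CC + 4 * Cτ * c₁) * x ^ (1 - 1 / 10000 : ℝ) =
          CC * x ^ (1 - 1 / 10000 : ℝ) + 4 * Cτ * c₁ * x ^ (1 - 1 / 10000 : ℝ) by ring]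
      have hfirst : _ ≤ CC * x ^ (1 - 1 / 10000 : ℝ) := (mul_le_mul_of_nonneg_left hφs (by positivity)).trans hnum
      exact add_le_add hfirst hsec
    -- the `v`-box: empty, one piece, or two pieces
    rcases le_or_gt ⌊hi₁⌋₊ ⌊lo₁⌋₊ with hBA | hAB
    · have hb₁e : b₁ = ∅ := by
        rw [hb₁, Finset.filter_eq_empty_iff]
        intro m hm
        have := Finset.mem_Ioc.mp hm; omega
      simp only [hb₁e, Finset.sum_empty, Finset.sum_const_zero, abs_zero, zero_mul]
      positivity
    have hlo₁1 : (1 : ℝ) ≤ lo₁ := hM₁1.trans hlo₁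
    have hA1 : 1 ≤ ⌊lo₁⌋₊ := Nat.le_floor (by exact_mod_cast hlo₁1)
    have hA1R : (1 : ℝ) ≤ (⌊lo₁⌋₊ : ℝ) := by exact_mod_cast hA1
    have hhi₁0 : 0 ≤ hi₁ := by
      by_contra hcon; push Not at hcon
      have : ⌊hi₁⌋₊ = 0 := Nat.floor_eq_zero.mpr (by linarith)
      omega
    have hBle : ((⌊hi₁⌋₊ : ℕ) : ℝ) ≤ 2 * M₁ := (Nat.floor_le hhi₁0).trans hhi₁
    have hAB' : ((⌊lo₁⌋₊ : ℕ) : ℝ) < ⌊hi₁⌋₊ := by exact_mod_cast hAB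
    have hAle : ((⌊lo₁⌋₊ : ℕ) : ℝ) ≤ 2 * M₁ := by linarith
    have hB2A1 : ⌊hi₁⌋₊ ≤ 2 * ⌊lo₁⌋₊ + 1 := by
      have h1 : ⌊hi₁⌋₊ ≤ ⌊2 * lo₁⌋₊ := Nat.floor_le_floor (by linarith)
      exact h1.trans (floor_two_mul_le (by linarith))
    have hCtot : (CC + 4 * Cτ * c₁) + (CC + 4 * Cτ * c₁) ≤ 12 * Cτ ^ 2 * c₁ ^ 2 + CB + (2 * CC + 8 * Cτ * c₁) := by
      have : 0 ≤ 12 * Cτ ^ 2 * c₁ ^ 2 := by positivity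
      linarith
    rcases le_or_gt ⌊hi₁⌋₊ (2 * ⌊lo₁⌋₊) with hB2 | hB2
    · -- one piece, `V = A`
      have hp := piece ⌊lo₁⌋₊ ⌊hi₁⌋₊ (⌊lo₁⌋₊ : ℝ) hA1R le_rfl (by exact_mod_cast hB2) (by linarith)
        (by
          have : ((⌊hi₁⌋₊ - ⌊lo₁⌋₊ : ℕ) : ℝ) ≤ ⌊hi₁⌋₊ := by exact_mod_cast Nat.sub_le _ _
          linarith) hb₁le
      refine hp.trans (mul_le_mul_of_nonneg_right ?_ hX0)
      have : 0 ≤ CC + 4 * Cτ * c₁ := by positivity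
      linarith
    · -- two pieces: `(A, 2A]` with `V = A` and `(2A, B]` with `V = 2A`
      have hsplitset : (Ioc ⌊lo₁⌋₊ ⌊hi₁⌋₊).filter (fun m : ℕ => (m : ZMod D) = (t₁ : ZMod D)) =
          (Ioc ⌊lo₁⌋₊ (2 * ⌊lo₁⌋₊)).filter (fun m : ℕ => (m : ZMod D) = (t₁ : ZMod D)) ∪
            (Ioc (2 * ⌊lo₁⌋₊) ⌊hi₁⌋₊).filter (fun m : ℕ => (m : ZMod D) = (t₁ : ZMod D)) := by
        rw [← Finset.filter_union, Finset.Ioc_union_Ioc_eq_Ioc (by omega) hB2.le]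
      have hdisj : Disjoint ((Ioc ⌊lo₁⌋₊ (2 * ⌊lo₁⌋₊)).filter (fun m : ℕ => (m : ZMod D) = (t₁ : ZMod D)))
          ((Ioc (2 * ⌊lo₁⌋₊) ⌊hi₁⌋₊).filter (fun m : ℕ => (m : ZMod D) = (t₁ : ZMod D))) := by
        refine Finset.disjoint_filter_filter ?_
        rw [Finset.disjoint_left]
        intro m h1 h2
        rw [Finset.mem_Ioc] at h1 h2
        omega
      have hsum : ∑ m₂ ∈ b₂, ∑ m₁ ∈ b₁, ∑ m₃ ∈ b₃, gAP s a (m₂ * m₁ * m₃) =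
          ∑ m₂ ∈ b₂, ∑ m₁ ∈ (Ioc ⌊lo₁⌋₊ (2 * ⌊lo₁⌋₊)).filter (fun m : ℕ => (m : ZMod D) = (t₁ : ZMod D)),
              ∑ m₃ ∈ b₃, gAP s a (m₂ * m₁ * m₃) +
            ∑ m₂ ∈ b₂, ∑ m₁ ∈ (Ioc (2 * ⌊lo₁⌋₊) ⌊hi₁⌋₊).filter (fun m : ℕ => (m : ZMod D) = (t₁ : ZMod D)),
              ∑ m₃ ∈ b₃, gAP s a (m₂ * m₁ * m₃) := by
        rw [← Finset.sum_add_distrib]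
        refine Finset.sum_congr rfl fun m₂ _ => ?_
        rw [hb₁, hsplitset, Finset.sum_union hdisj]
      rw [hsum]
      have hcard1 : ((((Ioc ⌊lo₁⌋₊ (2 * ⌊lo₁⌋₊)).filter (fun m : ℕ => (m : ZMod D) = (t₁ : ZMod D))).card : ℕ) : ℝ) ≤ 2 * M₁ := by
        refine le_trans ?_ hb₁le
        rw [hb₁, hsplitset]
        exact_mod_cast Finset.card_le_card Finset.subset_union_left
      have hcard2 : ((((Ioc (2 * ⌊lo₁⌋₊) ⌊hi₁⌋₊).filter (fun m : ℕ => (m : ZMod D) = (t₁ : ZMod D))).card : ℕ) : ℝ) ≤ 2 * M₁ := by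
        refine le_trans ?_ hb₁le
        rw [hb₁, hsplitset]
        exact_mod_cast Finset.card_le_card Finset.subset_union_right
      have hp1 := piece ⌊lo₁⌋₊ (2 * ⌊lo₁⌋₊) (⌊lo₁⌋₊ : ℝ) hA1R le_rfl (by push_cast; linarith) (by linarith)
        (by
          have : ((2 * ⌊lo₁⌋₊ - ⌊lo₁⌋₊ : ℕ) : ℝ) = ⌊lo₁⌋₊ := by
            rw [show 2 * ⌊lo₁⌋₊ - ⌊lo₁⌋₊ = ⌊lo₁⌋₊ by omega]
          rw [this]; linarith) hcard1
      have hp2 := piece (2 * ⌊lo₁⌋₊) ⌊hi₁⌋₊ (2 * (⌊lo₁⌋₊ : ℝ)) (by linarith) (by push_cast; rfl)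
        (by
          have : ((⌊hi₁⌋₊ : ℕ) : ℝ) ≤ ((2 * ⌊lo₁⌋₊ + 1 : ℕ) : ℝ) := by exact_mod_cast hB2A1
          push_cast at this; linarith) (by linarith)
        (by
          have : ((⌊hi₁⌋₊ - 2 * ⌊lo₁⌋₊ : ℕ) : ℝ) ≤ 1 := by
            have h := hB2A1
            exact_mod_cast (by omega : ⌊hi₁⌋₊ - 2 * ⌊lo₁⌋₊ ≤ 1)
          linarith) hcard2
      calc |∑ m₂ ∈ b₂, ∑ m₁ ∈ (Ioc ⌊lo₁⌋₊ (2 * ⌊lo₁⌋₊)).filter (fun m : ℕ => (m : ZMod D) = (t₁ : ZMod D)),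
              ∑ m₃ ∈ b₃, gAP s a (m₂ * m₁ * m₃) +
            ∑ m₂ ∈ b₂, ∑ m₁ ∈ (Ioc (2 * ⌊lo₁⌋₊) ⌊hi₁⌋₊).filter (fun m : ℕ => (m : ZMod D) = (t₁ : ZMod D)),
              ∑ m₃ ∈ b₃, gAP s a (m₂ * m₁ * m₃)| * (Nat.totient s : ℝ)
          ≤ (|∑ m₂ ∈ b₂, ∑ m₁ ∈ (Ioc ⌊lo₁⌋₊ (2 * ⌊lo₁⌋₊)).filter (fun m : ℕ => (m : ZMod D) = (t₁ : ZMod D)),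
              ∑ m₃ ∈ b₃, gAP s a (m₂ * m₁ * m₃)| +
            |∑ m₂ ∈ b₂, ∑ m₁ ∈ (Ioc (2 * ⌊lo₁⌋₊) ⌊hi₁⌋₊).filter (fun m : ℕ => (m : ZMod D) = (t₁ : ZMod D)),
              ∑ m₃ ∈ b₃, gAP s a (m₂ * m₁ * m₃)|) * (Nat.totient s : ℝ) :=
            mul_le_mul_of_nonneg_right (abs_add_le _ _) hφ.le
        _ ≤ (CC + 4 * Cτ * c₁) * x ^ (1 - 1 / 10000 : ℝ) + (CC + 4 * Cτ * c₁) * x ^ (1 - 1 / 10000 : ℝ) := by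
            rw [add_mul]; exact add_le_add hp1 hp2
        _ ≤ (12 * Cτ ^ 2 * c₁ ^ 2 + CB + (2 * CC + 8 * Cτ * c₁)) * x ^ (1 - 1 / 10000 : ℝ) := by
            rw [← add_mul]; exact mul_le_mul_of_nonneg_right hCtot hX0

end Literature.NumberTheory.Sieve.HeathBrown1986
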